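/-
Copyright: public-audit package `pub-balaban` (b2b-balaban), seat pv09-g6. Released under Apache 2.0 like Mathlib.
-/
import Mathlib
import Literature.MathematicalPhysics.QuantumFieldTheory.Balaban1983to89.B6Cov2156TorusSubset
import Literature.MathematicalPhysics.QuantumFieldTheory.Balaban1983to89.Beta.GaussianIntegral

/-!
# B6 (2.154) → (2.155) → (2.156) on the torus: the Jacobian (L^d)^{|Λ′|} of the elimination B = CB′, the Gaussian
source shift, and C^{(k)}_Λ = C(C*Δ_kC)⁻¹C* read off the generating function — kernel-checked bookkeeping

Source under audit: T. Bałaban, *Propagators and renormalization transformations for lattice gauge theories. II*,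
Commun. Math. Phys. **96** (1984) 223–250 [`Balaban1984PropagatorsII`, "B6"], pp. 249–250 [PDF 27–28] (journal page =
PDF page + 222; renders `b2b-balaban-ref1/pages/1984-cmp96-propagators-rt-II/1984-cmp96-propagators-rt-II-p027-x2.png`,
`-p028-x2.png`, read as images this session).  The paper is a manuscript UNDER ADJUDICATION by the audit cell
`pub-balaban`; nothing of it is asserted here: every declaration below is a definition or a sorry-free theorem about
real matrices and Lebesgue integrals, for the CONCRETE whole-torus elimination scheme of the sibling module
`B6Cov2156Torus` (C = `elimT L M`, Λ′ = all faces of the torus, remaining variables `freeT L M`) and, in §5, for its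
Λ-version of `B6Cov2156TorusSubset` (Λ = B(Λ′₀) ⊂ T^(k): variables = the Λ-bonds, constraints = the coarse bonds
meeting Λ′₀ `facesOf L M Λ'₀`, C = C_Λ = `elimLam L M Λ'₀`, remaining variables `lamFree L M Λ'₀`).

## WHAT IS PRINTED (verbatim)

p. 249: «Let us denote the covariance of the Gaussian integration in (2.152) by C^{(k)}, or by C^{(k)}_Λ, hence
∫dB↾_Λ δ(QB)δ_{Ax}(B) e^{−½⟨B,Δ_kB⟩+⟨J,B⟩} = Z^{(k)} e^{½⟨J,C^{(k)}_Λ J⟩}.   (2.154)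
An easy way to get a useful representation for C^{(k)}_Λ is to get rid of the unnecessary variables in the integral
above. We remove the variables B_b for b ⊂ Γ_{y,x} using the δ-functions δ_{Ax}(B). Next we remove the variables B_{b₀},
where b₀ is a bond belonging to B(c) for some c ∈ Λ′, and contained in c, using the δ-functions δ((QB)(c)). If we
denote the remaining variables by B′, then we can write B = CB′, where C is a linear» p. 250: «operator, and we have
(the left-hand side of (2.154)) = (L^d)^{|Λ′|} ∫dB′ e^{−½⟨B′,C*Δ_kCB′⟩+⟨C*J,B′⟩} = (L^d)^{|Λ′|} Z′^{(k)} e^{½⟨C*J,(C*Δ_kC)^{−1}C*J⟩},   (2.155)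
hence   C^{(k)}_Λ = C(C*Δ_kC)^{−1}C*.   (2.156)
By the definition of C we have of course that CB′ = 0 outside Λ, QCB′ = 0, (CB′)(Γ_{y,x}) = 0, x ∈ B(y), y ∈ Λ′, for
arbitrary B′.»

## What this file proves (kernel-checked, no `sorry`; axioms ⊆ {propext, Classical.choice, Quot.sound})

Throughout, the torus T_M = Z^d/(M₁Z × ⋯ × M_dZ) with L ∣ M_i, variables B indexed by the bonds of the box
(`B4.Idx (pbox M) d`), (QB)(c) = (Q₁B^per)(c) VERBATIM from (2.125) (`B6Lemma24PrintedShape.q1` of the periodic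
extension, as upstream), pivots b₀(c) = (`pivSite L c`, c₂), tree bonds `IsTree L (coarseSites L M)`.

* §1 THE COORDINATE CHANGE AND ITS JACOBIAN.  `coordT L M K` (K ⊆ faces, print: K = Λ′) is the matrix of the linear
  map Ψ_K : B ↦ (ΨB)(b) = (Q₁B^per)(c) if b = b₀(c), c ∈ K, and (ΨB)(b) = B(b) otherwise (`coordT_mulVec_apply`) — the
  substitution which turns δ((QB)(c)) into δ of a coordinate.  PROVED: Ψ_K is block-lower-triangular with respect to
  {pivots of K} ⊔ {other bonds} (`coordT_lower`), its pivot block is EXACTLY L^{−d}·𝟙 (`coordT_pivBlock`: the pivot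
  b₀(c) has multiplicity L in L^{d+1}(Q₁B)(c), `multP_pivSite`, and the pivots are private, `cOf_eq_of_multP_ne_zero`,
  both upstream), its other block is 𝟙 (`coordT_freeBlock`), |{pivots of K}| = |K| (`card_isPiv`), hence
  **`coordT_det`: det Ψ_K = (L^{−d})^{|K|}** and **`integral_comp_coordT`: ∫ F(Ψ_K B) dB = (L^d)^{|K|} ∫ F(y) dy** for
  every F (Lebesgue measure on ℝ^{bonds}; the linear change of variables is `Beta.GaussianIntegral.integral_comp_mulVec`
  of the sibling module, used by name) — THE FACTOR (L^d)^{|Λ′|} OF (2.155).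
* §2 Ψ AND THE ELIMINATION MATRIX C.  `extT w` = B′ extended by 0 to all bonds.  PROVED: **`coordT_mulVec_elimT`:
  Ψ_{Λ′}(CB′) = ext B′** (remaining coordinates B′, pivot coordinates (Q₁(CB′))(c) = 0, tree coordinates 0 — the
  sentence «QCB′ = 0, (CB′)(Γ_{y,x}) = 0» in coordinates), **`elimT_eq_coordT_inv_mulVec`: CB′ = Ψ_{Λ′}⁻¹(ext B′)**, and
  **`constrained_iff`**: QB = 0 ∧ B(Γ_{y,x}) = 0 ⟺ Ψ_{Λ′}B vanishes at every non-remaining bond — i.e. the product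
  δ(QB)δ_{Ax}(B) is the δ-function of the non-remaining coordinates of Ψ_{Λ′}B, whose pull-back along Ψ_{Λ′} costs the
  Jacobian |det Ψ_{Λ′}|⁻¹ = (L^d)^{|Λ′|} of §1 and lands on B = CB′ (`coordT_mulVec_of_constrained`, with
  `B6Cov2156Torus.elimT_restrT` upstream: every constrained B is C(B↾remaining)).  This is the first equality of (2.155).
* §3 THE SOURCE SHIFT [folklore].  For a symmetric real matrix A with det A a unit and any K:
  **`integral_exp_quad_lin`: ∫ e^{−½⟨x,Ax⟩+⟨K,x⟩} dx = e^{½⟨K,A⁻¹K⟩} ∫ e^{−½⟨x,Ax⟩} dx** (translation x = A⁻¹K + y of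
  Lebesgue measure and completion of the square `quad_shift`; no integrability hypothesis: both sides are the integral
  of translates of one function).
* §4 (2.155) AND (2.156) FOR THE TORUS SCHEME.  `redInt L M Δ J` := ∫dB′ e^{−½⟨CB′,ΔCB′⟩+⟨J,CB′⟩} (the integrand of
  (2.154) at B = CB′), `Zred L M Δ` := Z′ = ∫dB′ e^{−½⟨B′,C*ΔCB′⟩} (left UNEVALUATED).  PROVED: the substitution
  identities ⟨CB′,ΔCB′⟩ = ⟨B′,C*ΔCB′⟩, ⟨J,CB′⟩ = ⟨C*J,B′⟩ (`quad_sandwich`, `lin_sandwich`), so `redInt` IS the first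
  integral of (2.155) (`redInt_eq_first`); **`redInt_eq`: ∫dB′ e^{−½⟨B′,C*ΔCB′⟩+⟨C*J,B′⟩} = Z′·e^{½⟨C*J,(C*ΔC)⁻¹C*J⟩}**
  for Δ symmetric with det(C*ΔC) a unit (the second equality of (2.155)), and **`eq_2155`** = the display multiplied by
  (L^d)^{|Λ′|}; **`quad_cov` / `cov_quad`: ⟨C*J,(C*ΔC)⁻¹C*J⟩ = ⟨J, C(C*ΔC)⁻¹C* J⟩** with C(C*ΔC)⁻¹C* =
  `(bondReductionT L M Δ).cov` (upstream, `rfl`), `cov_isSymm`, and **`cov_unique` / `cov_unique'`**: C(C*ΔC)⁻¹C* is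
  THE symmetric matrix whose quadratic form is the
  exponent of (2.155) — the word «hence» of (2.156) (a centred Gaussian generating function Z·e^{½⟨J,SJ⟩} with S
  symmetric determines S, `B6Cov2156Torus.eq_of_quad_eq` upstream).
* §5 THE SAME FOR THE Λ-INTEGRAL «∫dB↾_Λ», Λ = B(Λ′₀) ⊂ T^(k).  Variables = the Λ-bonds (`LamIdx`, at least one
  end-point in Λ), extension by zero outside Λ = `zeroExt`, Ψ^Λ = `coordLam L M Λ'₀` = the Λ-bond block of Ψ_K, K = `facesOf L M Λ'₀`
  (the coarse bonds meeting Λ′₀), whose pivot rows are B ↦ (Q₁B̃^per)(c), B̃ = B extended by zero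
  (`coordLam_mulVec_apply`).  PROVED: **`coordLam_det`: det Ψ^Λ = (L^{−d})^{|K|}** (the pivots of K are Λ-bonds,
  `isLam_piv`, `card_isPiv_lam`), **`integral_comp_coordLam`: ∫ F(Ψ^Λ B) dB = (L^d)^{|K|} ∫ F** on ℝ^{Λ-bonds},
  **`coordLam_mulVec_elimLam`: Ψ^Λ(C_ΛB′) = ext B′**, `lamVec_eq_coordLam_inv_mulVec`: C_ΛB′ = (Ψ^Λ)⁻¹ ext B′,
  **`constrained_iff_lam`**: (Q₁B̃^per)(c) = 0 at the c meeting Λ′₀ ∧ B(Γ_{y,x}) = 0 on the blocks of Λ′₀ ⟺ Ψ^Λ B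
  vanishes at every non-remaining Λ-bond, and `coordLam_mulVec_of_constrained` (the fibre is B̃ = C_Λ(B̃↾remaining),
  upstream `elimLam_restr`).  With `B6Cov2156TorusSubset.sandwich_eq_of_agree` / `subFamilyT_cov` upstream (C_Λ*ΔC_Λ and
  C_Λ(C_Λ*ΔC_Λ)⁻¹C_Λ* = `(bondReductionLam L M Λ'₀ Δ).cov`), §3–§4 apply verbatim to C = C_Λ (the source shift and the
  polarization are stated for an arbitrary matrix C through `quad_sandwich`, `lin_sandwich`, `quad_cov`, `eq_of_quad_eq`).
* §6 (v1.1) Z′^{(k)} EVALUATED.  From (2.153)_T (`B6Cov2156Torus.LowerOnConstrainedT L M Δ γ`) and ‖CB′‖ ≥ ‖B′‖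
  (`elimT_iso` upstream): **`sandwich_lower`** γ‖B′‖² ≤ ⟨B′,C*ΔCB′⟩ (the chain (2.157) *"⟨B′, C*Δ_kCB′⟩ ≥
  (γ₀/12d²)L^{−d−1}‖CB′‖² ≥ γ′₀‖B′‖², (2.157) where γ′₀ = (γ₀/12d²)L^{−d−1}"* for a general (2.153)_T-constant γ;
  the printed γ′₀ itself in §8), **`sandwich_posDef`** C*ΔC is positive definite (Δ symmetric, γ > 0), **`Zred_eq`**
  Z′ = √(2π)^{|B′|}/√det(C*ΔC) (the Gaussian integral `Beta.GaussianIntegral.integral_exp_neg_half_quadForm` of the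
  sibling module BY NAME), `Zred_pos`, **`eq_2155_eval`** = (2.155) with Z′ evaluated; and for THE matrix Δ_k =
  `deltaPol M n` of the (1.66) form ((2.153)_T discharged upstream by `lowerOnConstrainedT_of_represents`,
  `represents_deltaPol`, γ = `gamma2153 d L` > 0): **`sandwich_posDef_deltaPol`, `Zred_deltaPol`, `eq_2155_deltaPol`** —
  UNCONDITIONAL for d ≥ 2, L ≥ 1, n ≥ 1, L ∣ M_i (no hypothesis on Δ_k is left; its decay is not needed for (2.155)).
* §7 (v1.1) THE SAME FOR EVERY SUB-FAMILY C_S of the torus scheme (S ⊆ remaining variables, C_S = `elimTS`, reduction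
  `subFamilyT` upstream), in particular C_Λ = `elimLam` (S = `lamFree L M Λ'₀`): `redIntS`, `ZredS`, `redIntS_eq_first`,
  `covS_quad`, **`redIntS_eq`** (second equality of (2.155)), **`cov_uniqueS`** (the word «hence» before (2.156)), `sandwich_lowerS`,
  **`sandwich_posDefS`**, **`ZredS_eq`**, `redIntS_eval`, and for the (1.66) form **`eq_2155_lam_deltaPol`**:
  (L^d)^{|Λ′|}∫dB′e^{−½⟨C_ΛB′,Δ_kC_ΛB′⟩+⟨J,C_ΛB′⟩} = (L^d)^{|Λ′|}·√(2π)^{|B′|}/√det(C_Λ*Δ_kC_Λ)·e^{½⟨J,C^{(k)}_ΛJ⟩} with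
  C^{(k)}_Λ = `(bondReductionLam L M Λ'₀ (deltaPol M n)).cov`, and `ZredLam_deltaPol` (C_Λ*Δ_kC_Λ > 0, Z′ evaluated) —
  unconditionally.
* §8 (v1.2) (2.157) WITH ITS PRINTED CONSTANT for the (1.66) form: *"The inequality (2.153) implies ⟨B′, C*Δ_kCB′⟩ ≥
  (γ₀/12d²)L^{−d−1}‖CB′‖² ≥ γ′₀‖B′‖², (2.157) where γ′₀ = (γ₀/12d²)L^{−d−1}."* — `ineq_2157_mid` ((2.153)_T at B = CB′:
  γ‖CB′‖² ≤ ⟨B′,C*ΔCB′⟩), **`ineq_2157_deltaPol`** (both printed inequalities with γ′₀ = `gamma2153 d L` =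
  ((4/π²)^{d+2}/12d²)·L^{−(d+1)}, `gamma2153_eq`; γ₀ = (4/π²)^{d+2} of (1.67) = (2.118), as discharged upstream), and the
  same for every sub-family C_S / C_Λ (`ineq_2157_midS`, `ineq_2157_lam_deltaPol`) — unconditionally (d ≥ 2, L ≥ 1,
  n ≥ 1, L ∣ M_i).

## HONEST SCOPE (what is NOT claimed)

(i) δ-FUNCTIONS ARE NOT OBJECTS OF THIS FORMALISATION: the left-hand side of (2.154) is not a Lean term.  What is
certified is the linear algebra and measure theory the display (2.155) consists of: the coordinate change Ψ_{Λ′} with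
|det Ψ_{Λ′}|⁻¹ = (L^d)^{|Λ′|} under which δ(QB)δ_{Ax}(B) becomes the δ of |Λ′| + |tree| coordinates (`constrained_iff`),
the identification of the remaining fibre with B = CB′ (`coordT_mulVec_elimT`, `elimT_eq_coordT_inv_mulVec`), the
change-of-variables formula for Ψ_{Λ′} (`integral_comp_coordT`), and the evaluation of the resulting B′-integral up to
the constant Z′ (`redInt_eq`).  Reading '∫dB δ(ΨB↾non-remaining) G(B)' (our notation) as |det Ψ|⁻¹∫dB′ G(Ψ⁻¹ ext B′) is the standard
convention (cf. the cell's row D-pv16.2); it is not a theorem here.  (ii) Z′^{(k)} IS evaluated (§6–§7, v1.1) as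
√(2π)^{|B′|}/√det(C*ΔC) whenever C*ΔC > 0 — proved from (2.153)_T with γ > 0, hence unconditionally for Δ_k of the (1.66)
form; Z^{(k)} of (2.154) is NOT a separate Lean term: read in the convention of (i) it is (L^d)^{|Λ′|}·Z′^{(k)} by (2.155)
at J = 0 (`eq_2155_eval`), nothing more is claimed about it.  (iii) For a subset Λ ⊂ T^(k) the Jacobian, the change of
variables, Ψ^Λ(C_ΛB′) = ext B′ and the δ-bookkeeping (§5) and — since v1.1, §7 — the two displayed equalities of (2.155),
the polarization (2.156) and Z′ are ALL spelled out for C_Λ (indeed for every sub-family C_S of the torus scheme).  (iv)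
Nothing about the decay of Δ_k or of C^{(k)}_Λ (that is `B6Cov2156Torus(Subset)`, residual hypothesis `KernelDecay`
unchanged; of the printed sentence *"It gives us an exponential decay, and all the other properties, for the operator
(C*Δ_kC)^{−1}, hence for C^{(k)}_Λ also."* (p.250, invoking Sect. 5 of its ref. [3]) NOTHING beyond the transport of an
ASSUMED decay of Δ_k is formalised, there).  (v) d,
L ≥ 1 arbitrary (d ≥ 2, n ≥ 1 where (2.153)_T is discharged), all M_i ≥ 1 with L ∣ M_i where stated.

Unit `b2b-balaban-pv09-g6` (surge node prover #09, gen 6), journal claims G-B6-2155-JACOBIAN-TORUS (v1, §1–§5) and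
G-B6-2155-ZPRIME (v1.1, §6–§7, append-only: every v1 declaration unchanged; v1.2 = DOCFIX of two misquoted guillemet
passages of v1.1 + §8, every v1/v1.1 declaration unchanged; v1.3 = DOCFIX only, journal ERRATUM-2 07:19:40Z: an
unsourced guillemet phrase of v1 (`quad_sandwich`), a non-verbatim paraphrase in HONEST SCOPE (iv) and three notation
glosses wrongly set in guillemets were re-worded — every declaration unchanged); sibling modules `B6Cov2156TorusSubset`
(hence `B6Cov2156Torus` v1.1) and `Beta.GaussianIntegral` are imported, none is edited (v1's header sentence «(`B6Cov2156TorusSubset`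
is only referred to)» was inaccurate — it is imported since v1 — and is corrected here).  Value = kernel certificate of
displayed bookkeeping, NOT summit progress.
-/

open Finset Matrix MeasureTheory

namespace Literature.MathematicalPhysics.QuantumFieldTheory.Balaban1983to89.B6Jacobian2155Torus

open B6BondElimination (pivSite cOf cOf_snd pivSite_cOf cOf_pivSite IsTree not_isTree_of_piv freeB mem_freeB
  SubReduction)
open B6Lemma24PrintedShape (q1)
open B6Lemma24Torus (pbox mem_pbox coarseSites faces mem_faces)
open B6LowerBound2153Torus (pos_of_neZero)
open B6Cov2156Torus (multP multP_pivSite cOf_eq_of_multP_ne_zero pivSite_mem_pbox faces_dvd q1_perExt_eq_sum_multP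
  freeT elimT elimT_mulVec_apply q1_elimT_mulVec restrT elimT_restrT perExt one_le_M bondReductionT bondReductionT_cov
  eq_of_quad_eq)
open Beta.GaussianIntegral (integral_comp_mulVec)

noncomputable section

variable {d : ℕ} {L : ℕ} {M : Fin d → ℕ}

/-! ## §1  The coordinate change Ψ_K and its Jacobian -/

section Coord

variable (L) (M)

/-- `p` is the pivot bond b₀(c) of a constraint c ∈ K: c = `cOf p` (so p = (pivSite c, c₂)). [folklore] -/
abbrev IsPiv (K : Finset ((Fin d → ℤ) × Fin d)) (p : B4.Idx (pbox M) d) : Prop :=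
  cOf L (p.1 : Fin d → ℤ) p.2 ∈ K

/-- THE COORDINATE CHANGE Ψ_K of the passage (2.154) → (2.155): the row of a pivot b₀(c), c ∈ K, is the functional
B ↦ (Q₁B^per)(c) (weights L^{−(d+1)}·multP_c(b), `q1_perExt_eq_sum_multP` upstream); every other row is a coordinate row.
[cite: Balaban1984PropagatorsII, (2.154)–(2.155) pp.249–250] -/
def coordT (K : Finset ((Fin d → ℤ) × Fin d)) : Matrix (B4.Idx (pbox M) d) (B4.Idx (pbox M) d) ℝ :=
  Matrix.of fun p j =>
    if cOf L (p.1 : Fin d → ℤ) p.2 ∈ K then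
      ((L : ℝ) ^ (d + 1))⁻¹ * (multP L M (cOf L (p.1 : Fin d → ℤ) p.2) (j.1 : Fin d → ℤ) j.2 : ℝ)
    else if j = p then 1 else 0

variable {L M}

/-- The entries of Ψ_K, unfolded. [folklore] -/
theorem coordT_apply (K : Finset ((Fin d → ℤ) × Fin d)) (p j : B4.Idx (pbox M) d) :
    coordT L M K p j =
      if cOf L (p.1 : Fin d → ℤ) p.2 ∈ K then
        ((L : ℝ) ^ (d + 1))⁻¹ * (multP L M (cOf L (p.1 : Fin d → ℤ) p.2) (j.1 : Fin d → ℤ) j.2 : ℝ)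
      else if j = p then 1 else 0 :=
  rfl

/-- KERNEL-CHECKED: (Ψ_K B)(b₀(c)) = (Q₁B^per)(c) for c ∈ K, and (Ψ_K B)(b) = B(b) at every other bond — the
substitution turning δ((QB)(c)) into the δ-function of a coordinate. [cite: Balaban1984PropagatorsII, p.249] -/
theorem coordT_mulVec_apply [∀ μ, NeZero (M μ)] (K : Finset ((Fin d → ℤ) × Fin d))
    (B : B4.Idx (pbox M) d → ℝ) (p : B4.Idx (pbox M) d) :
    (coordT L M K *ᵥ B) p =
      if cOf L (p.1 : Fin d → ℤ) p.2 ∈ K then q1 L (perExt M B) (cOf L (p.1 : Fin d → ℤ) p.2) else B p := by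
  simp only [Matrix.mulVec, dotProduct, coordT, Matrix.of_apply]
  by_cases hp : cOf L (p.1 : Fin d → ℤ) p.2 ∈ K
  · simp only [if_pos hp]
    rw [q1_perExt_eq_sum_multP, Finset.mul_sum]
    exact Finset.sum_congr rfl fun j _ => by ring
  · simp only [if_neg hp]
    rw [Finset.sum_eq_single p]
    · rw [if_pos rfl, one_mul]
    · intro j _ hj
      rw [if_neg hj, zero_mul]
    · intro h
      exact absurd (Finset.mem_univ p) h

/-- Ψ_K is block-lower-triangular: a non-pivot row has no entry in a pivot column. [folklore] -/
theorem coordT_lower (K : Finset ((Fin d → ℤ) × Fin d)) :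
    ∀ i, ¬ IsPiv L M K i → ∀ j, IsPiv L M K j → coordT L M K i j = 0 := by
  intro i hi j hj
  rw [coordT_apply, if_neg hi, if_neg]
  rintro rfl
  exact hi hj

/-- KERNEL-CHECKED PIVOT BLOCK: for K ⊆ faces and pivots p = b₀(c), j = b₀(c′) (c, c′ ∈ K) the entry of Ψ_K is
L^{−(d+1)}·multP_c(b₀(c′)) = L^{−d} if c = c′ (multiplicity L, `multP_pivSite`) and 0 otherwise (private pivots,
`cOf_eq_of_multP_ne_zero`). [folklore] -/
theorem coordT_piv_piv [∀ μ, NeZero (M μ)] (hL : 0 < L) (hLM : ∀ i, L ∣ M i)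
    {K : Finset ((Fin d → ℤ) × Fin d)} (hK : K ⊆ faces L M) {p j : B4.Idx (pbox M) d}
    (hp : IsPiv L M K p) (hj : IsPiv L M K j) :
    coordT L M K p j = if j = p then ((L : ℝ) ^ d)⁻¹ else 0 := by
  rw [coordT_apply, if_pos hp]
  obtain ⟨c, hc⟩ : ∃ c, cOf L (p.1 : Fin d → ℤ) p.2 = c := ⟨_, rfl⟩
  have hcF : c ∈ faces L M := hc ▸ hK hp
  have hp1 : (p.1 : Fin d → ℤ) = pivSite L c := by rw [← hc, pivSite_cOf]
  have hp2 : p.2 = c.2 := by rw [← hc, cOf_snd]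
  rw [hc]
  by_cases hjp : j = p
  · subst hjp
    rw [if_pos rfl, hp1, hp2, multP_pivSite hL (pos_of_neZero M) hLM hcF]
    have hL' : (L : ℝ) ≠ 0 := by exact_mod_cast hL.ne'
    rw [pow_succ, mul_inv, mul_assoc, inv_mul_cancel₀ hL', mul_one]
  · rw [if_neg hjp]
    suffices h0 : multP L M c (j.1 : Fin d → ℤ) j.2 = 0 by rw [h0, Nat.cast_zero, mul_zero]
    by_contra h0
    have e := cOf_eq_of_multP_ne_zero hL hLM hcF (hK hj) h0
    apply hjp
    have hj1 : (j.1 : Fin d → ℤ) = (p.1 : Fin d → ℤ) := by rw [hp1, ← e, pivSite_cOf]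
    have hj2 : j.2 = p.2 := by rw [hp2, ← e, cOf_snd]
    exact Prod.ext (Subtype.ext hj1) hj2

/-- KERNEL-CHECKED: the pivot block of Ψ_K is EXACTLY L^{−d}·𝟙. [folklore] -/
theorem coordT_pivBlock [∀ μ, NeZero (M μ)] (hL : 0 < L) (hLM : ∀ i, L ∣ M i)
    {K : Finset ((Fin d → ℤ) × Fin d)} (hK : K ⊆ faces L M) :
    toSquareBlockProp (coordT L M K) (IsPiv L M K) =
      ((L : ℝ) ^ d)⁻¹ • (1 : Matrix {p // IsPiv L M K p} {p // IsPiv L M K p} ℝ) := by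
  ext i j
  rw [toSquareBlockProp_def, Matrix.of_apply, coordT_piv_piv hL hLM hK i.2 j.2, Matrix.smul_apply, smul_eq_mul,
    Matrix.one_apply]
  by_cases h : i = j
  · subst h
    rw [if_pos rfl, if_pos rfl, mul_one]
  · rw [if_neg (fun e => h (Subtype.ext e).symm), if_neg h, mul_zero]

/-- The other diagonal block of Ψ_K is 𝟙. [folklore] -/
theorem coordT_freeBlock (K : Finset ((Fin d → ℤ) × Fin d)) :
    toSquareBlockProp (coordT L M K) (fun p => ¬ IsPiv L M K p) = 1 := by
  ext i j
  rw [toSquareBlockProp_def, Matrix.of_apply, coordT_apply, if_neg i.2, Matrix.one_apply]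
  by_cases h : i = j
  · subst h
    rw [if_pos rfl, if_pos rfl]
  · rw [if_neg (fun e => h (Subtype.ext e).symm), if_neg h]

/-- KERNEL-CHECKED: the pivots of K ⊆ faces are in bijection with K (c ↦ b₀(c) = (pivSite c, c₂), inverse `cOf`), so
there are |K| of them (print: |Λ′| constraints δ((QB)(c)), one pivot each). [folklore] -/
theorem card_isPiv [∀ μ, NeZero (M μ)] (hL : 0 < L) (hLM : ∀ i, L ∣ M i)
    {K : Finset ((Fin d → ℤ) × Fin d)} (hK : K ⊆ faces L M) :
    Fintype.card {p : B4.Idx (pbox M) d // IsPiv L M K p} = K.card := by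
  rw [Fintype.card_subtype]
  refine Finset.card_bij' (fun p _ => cOf L (p.1 : Fin d → ℤ) p.2)
    (fun c hc => (⟨pivSite L c, pivSite_mem_pbox hL hLM (hK hc)⟩, c.2)) ?_ ?_ ?_ ?_
  · intro p hp
    simpa using hp
  · intro c hc
    simp only [Finset.mem_filter, Finset.mem_univ, true_and]
    show cOf L (pivSite L c) c.2 ∈ K
    rwa [cOf_pivSite]
  · intro p hp
    refine Prod.ext (Subtype.ext ?_) ?_
    · show pivSite L (cOf L (p.1 : Fin d → ℤ) p.2) = (p.1 : Fin d → ℤ)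
      rw [pivSite_cOf]
    · show (cOf L (p.1 : Fin d → ℤ) p.2).2 = p.2
      rw [cOf_snd]
  · intro c hc
    show cOf L (pivSite L c) c.2 = c
    rw [cOf_pivSite]

/-- **KERNEL-CHECKED JACOBIAN: det Ψ_K = (L^{−d})^{|K|}** for K ⊆ faces (block-triangular with diagonal blocks
L^{−d}·𝟙 on the |K| pivots and 𝟙 elsewhere).  With K = Λ′: |det Ψ_{Λ′}|⁻¹ = (L^d)^{|Λ′|}, the factor of (2.155).
[cite: Balaban1984PropagatorsII, (2.155) p.250] -/
theorem coordT_det [∀ μ, NeZero (M μ)] (hL : 0 < L) (hLM : ∀ i, L ∣ M i)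
    {K : Finset ((Fin d → ℤ) × Fin d)} (hK : K ⊆ faces L M) :
    (coordT L M K).det = (((L : ℝ) ^ d)⁻¹) ^ K.card := by
  rw [Matrix.twoBlockTriangular_det (coordT L M K) (IsPiv L M K) (coordT_lower K), coordT_pivBlock hL hLM hK,
    coordT_freeBlock, Matrix.det_one, mul_one, Matrix.det_smul, Matrix.det_one, mul_one, card_isPiv hL hLM hK]

/-- det Ψ_K ≠ 0 (L ≥ 1). [folklore] -/
theorem coordT_det_ne_zero [∀ μ, NeZero (M μ)] (hL : 0 < L) (hLM : ∀ i, L ∣ M i)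
    {K : Finset ((Fin d → ℤ) × Fin d)} (hK : K ⊆ faces L M) : (coordT L M K).det ≠ 0 := by
  rw [coordT_det hL hLM hK]
  have hLr : (0 : ℝ) < L := by exact_mod_cast hL
  positivity

/-- **KERNEL-CHECKED CHANGE OF VARIABLES: ∫ F(Ψ_K B) dB = (L^d)^{|K|} ∫ F(y) dy** for every F (Lebesgue measure on
ℝ^{bonds of the box}; `Beta.GaussianIntegral.integral_comp_mulVec`).  With K = Λ′ this is THE FACTOR (L^d)^{|Λ′|} of
(2.155): pulling the δ-function of the non-remaining coordinates back along Ψ_{Λ′} costs |det Ψ_{Λ′}|⁻¹ = (L^d)^{|Λ′|}.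
[cite: Balaban1984PropagatorsII, (2.155) p.250] -/
theorem integral_comp_coordT [∀ μ, NeZero (M μ)] (hL : 0 < L) (hLM : ∀ i, L ∣ M i)
    {K : Finset ((Fin d → ℤ) × Fin d)} (hK : K ⊆ faces L M) (F : (B4.Idx (pbox M) d → ℝ) → ℝ) :
    ∫ B, F (coordT L M K *ᵥ B) = ((L : ℝ) ^ d) ^ K.card * ∫ y, F y := by
  have hLr : (0 : ℝ) < L := by exact_mod_cast hL
  rw [integral_comp_mulVec (coordT L M K) (coordT_det_ne_zero hL hLM hK) F, coordT_det hL hLM hK,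
    abs_of_pos (by positivity), ← inv_pow, inv_inv]

end Coord

/-! ## §2  Ψ_{Λ′} and the elimination matrix C -/

section Elim

variable (L) (M)

/-- B′ extended by zero from the remaining variables to all bonds of the box. [folklore] -/
def extT (w : freeT L M → ℝ) : B4.Idx (pbox M) d → ℝ := fun p => if hp : p ∈ freeT L M then w ⟨p, hp⟩ else 0

variable {L M}

/-- The entries of ext B′. [folklore] -/
theorem extT_apply (w : freeT L M → ℝ) (p : B4.Idx (pbox M) d) :
    extT L M w p = if hp : p ∈ freeT L M then w ⟨p, hp⟩ else 0 :=
  rfl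

/-- **KERNEL-CHECKED: Ψ_{Λ′}(CB′) = ext B′** — in the coordinates Ψ_{Λ′}, the vector CB′ has remaining coordinates B′,
pivot coordinates (Q₁(CB′)^per)(c) = 0 («QCB′ = 0») and tree coordinates 0 («(CB′)(Γ_{y,x}) = 0»).
[cite: Balaban1984PropagatorsII, (2.155) p.250] -/
theorem coordT_mulVec_elimT [∀ μ, NeZero (M μ)] (hL : 0 < L) (hLM : ∀ i, L ∣ M i) (w : freeT L M → ℝ) :
    coordT L M (faces L M) *ᵥ (elimT L M *ᵥ w) = extT L M w := by
  funext p
  rw [coordT_mulVec_apply, extT_apply]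
  by_cases hp : cOf L (p.1 : Fin d → ℤ) p.2 ∈ faces L M
  · rw [if_pos hp, q1_elimT_mulVec hL hLM w hp, dif_neg]
    exact fun h => (mem_freeB.1 h).1 hp
  · rw [if_neg hp, elimT_mulVec_apply]
    by_cases hf : p ∈ freeT L M
    · rw [dif_pos hf, dif_pos hf]
    · rw [dif_neg hf, dif_neg hf]
      have ht : IsTree L (coarseSites L M) p := by
        by_contra ht
        exact hf (mem_freeB.2 ⟨hp, ht⟩)
      rw [if_pos ht]

/-- **KERNEL-CHECKED: CB′ = Ψ_{Λ′}⁻¹(ext B′)** — the elimination matrix C of p. 250 is the inverse coordinate change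
applied to the remaining coordinates (the fibre of δ(QB)δ_{Ax}(B) over B′). [cite: Balaban1984PropagatorsII, p.250] -/
theorem elimT_eq_coordT_inv_mulVec [∀ μ, NeZero (M μ)] (hL : 0 < L) (hLM : ∀ i, L ∣ M i) (w : freeT L M → ℝ) :
    elimT L M *ᵥ w = (coordT L M (faces L M))⁻¹ *ᵥ extT L M w := by
  have hdet : IsUnit (coordT L M (faces L M)).det :=
    isUnit_iff_ne_zero.2 (coordT_det_ne_zero hL hLM (Finset.Subset.refl _))
  rw [← coordT_mulVec_elimT hL hLM w, Matrix.mulVec_mulVec, Matrix.nonsing_inv_mul _ hdet, Matrix.one_mulVec]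

/-- **KERNEL-CHECKED: δ(QB)δ_{Ax}(B) is the δ-function of the non-remaining coordinates of Ψ_{Λ′}B** — B satisfies
(Q₁B^per)(c) = 0 at every face and B = 0 on every tree bond IFF (Ψ_{Λ′}B)(b) = 0 at every bond b which is not a
remaining variable (the pivots carry the constraints, the tree bonds carry themselves, `not_isTree_of_piv` upstream
separates the two). [cite: Balaban1984PropagatorsII, (2.154)–(2.155) pp.249–250] -/
theorem constrained_iff [∀ μ, NeZero (M μ)] (hL : 0 < L) (hLM : ∀ i, L ∣ M i) (B : B4.Idx (pbox M) d → ℝ) :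
    ((∀ c ∈ faces L M, q1 L (perExt M B) c = 0) ∧ ∀ p, IsTree L (coarseSites L M) p → B p = 0) ↔
      ∀ p, p ∉ freeT L M → (coordT L M (faces L M) *ᵥ B) p = 0 := by
  constructor
  · rintro ⟨h1, h2⟩ p hp
    rw [coordT_mulVec_apply]
    by_cases hc : cOf L (p.1 : Fin d → ℤ) p.2 ∈ faces L M
    · rw [if_pos hc]
      exact h1 _ hc
    · rw [if_neg hc]
      have ht : IsTree L (coarseSites L M) p := by
        by_contra ht
        exact hp (mem_freeB.2 ⟨hc, ht⟩)
      exact h2 p ht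
  · intro h
    refine ⟨fun c hc => ?_, fun p hp => ?_⟩
    · set p : B4.Idx (pbox M) d := (⟨pivSite L c, pivSite_mem_pbox hL hLM hc⟩, c.2) with hp_def
      have hcp : cOf L (p.1 : Fin d → ℤ) p.2 = c := by
        show cOf L (pivSite L c) c.2 = c
        rw [cOf_pivSite]
      have hpf : p ∉ freeT L M := fun hf => (mem_freeB.1 hf).1 (by rw [hcp]; exact hc)
      have h0 := h p hpf
      rw [coordT_mulVec_apply, hcp, if_pos hc] at h0
      exact h0
    · have hpf : p ∉ freeT L M := fun hf => (mem_freeB.1 hf).2 hp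
      have h0 := h p hpf
      rw [coordT_mulVec_apply] at h0
      by_cases hc : cOf L (p.1 : Fin d → ℤ) p.2 ∈ faces L M
      · exfalso
        refine not_isTree_of_piv hL (faces_dvd hc) p ?_ ?_ hp
        · rw [pivSite_cOf]
        · rw [cOf_snd]
      · rwa [if_neg hc] at h0

/-- KERNEL-CHECKED (the fibre): a constrained, axially gauged B is C applied to its remaining coordinates, and
Ψ_{Λ′}B = ext(B↾remaining) (upstream `elimT_restrT` in the coordinates Ψ_{Λ′}).
[cite: Balaban1984PropagatorsII, (2.154)–(2.155) pp.249–250] -/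
theorem coordT_mulVec_of_constrained [∀ μ, NeZero (M μ)] (hL : 0 < L) (hLM : ∀ i, L ∣ M i)
    {B : B4.Idx (pbox M) d → ℝ} (h1 : ∀ c ∈ faces L M, q1 L (perExt M B) c = 0)
    (h2 : ∀ p, IsTree L (coarseSites L M) p → B p = 0) :
    elimT L M *ᵥ restrT B = B ∧ coordT L M (faces L M) *ᵥ B = extT L M (restrT B) := by
  have e := elimT_restrT hL hLM h1 h2
  refine ⟨e, ?_⟩
  rw [← coordT_mulVec_elimT hL hLM (restrT B), e]

end Elim

/-! ## §3  The Gaussian source shift [folklore] -/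

section SourceShift

variable {ι : Type*} [Fintype ι] [DecidableEq ι]

omit [DecidableEq ι] in
/-- Completion of the square: for A symmetric with Ah = K,
−½⟨h+y, A(h+y)⟩ + ⟨K, h+y⟩ = ½⟨K,h⟩ − ½⟨y,Ay⟩. [folklore] -/
theorem quad_shift (A : Matrix ι ι ℝ) (hA : A.IsSymm) (K h y : ι → ℝ) (hh : A *ᵥ h = K) :
    -(1 / 2 : ℝ) * ((h + y) ⬝ᵥ A *ᵥ (h + y)) + K ⬝ᵥ (h + y) =
      (1 / 2 : ℝ) * (K ⬝ᵥ h) + -(1 / 2 : ℝ) * (y ⬝ᵥ A *ᵥ y) := by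
  have h1 : h ⬝ᵥ A *ᵥ y = K ⬝ᵥ y := by
    rw [Matrix.dotProduct_mulVec, ← Matrix.mulVec_transpose, hA.eq, hh]
  have h2 : y ⬝ᵥ A *ᵥ h = K ⬝ᵥ y := by rw [hh, dotProduct_comm]
  have h3 : h ⬝ᵥ A *ᵥ h = K ⬝ᵥ h := by rw [hh, dotProduct_comm]
  rw [Matrix.mulVec_add, add_dotProduct, dotProduct_add, dotProduct_add, dotProduct_add, h1, h2, h3]
  ring

/-- **THE GAUSSIAN SOURCE SHIFT: ∫ e^{−½⟨x,Ax⟩+⟨K,x⟩} dx = e^{½⟨K,A⁻¹K⟩} ∫ e^{−½⟨x,Ax⟩} dx** for A symmetric with det A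
a unit (translation invariance of Lebesgue measure on ι → ℝ under x = A⁻¹K + y and `quad_shift`; no integrability
hypothesis is needed).  This is the second equality of (2.155) with A = C*Δ_kC, K = C*J, Z′^{(k)} = ∫ e^{−½⟨x,Ax⟩}dx.
[folklore] -/
theorem integral_exp_quad_lin (A : Matrix ι ι ℝ) (hA : A.IsSymm) (hdet : IsUnit A.det) (K : ι → ℝ) :
    ∫ x : ι → ℝ, Real.exp (-(1 / 2 : ℝ) * (x ⬝ᵥ A *ᵥ x) + K ⬝ᵥ x) =
      Real.exp ((1 / 2 : ℝ) * (K ⬝ᵥ A⁻¹ *ᵥ K)) * ∫ x : ι → ℝ, Real.exp (-(1 / 2 : ℝ) * (x ⬝ᵥ A *ᵥ x)) := by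
  set h : ι → ℝ := A⁻¹ *ᵥ K with hh_def
  have hh : A *ᵥ h = K := by
    rw [hh_def, Matrix.mulVec_mulVec, Matrix.mul_nonsing_inv _ hdet, Matrix.one_mulVec]
  calc ∫ x : ι → ℝ, Real.exp (-(1 / 2 : ℝ) * (x ⬝ᵥ A *ᵥ x) + K ⬝ᵥ x)
      = ∫ y : ι → ℝ, Real.exp (-(1 / 2 : ℝ) * ((h + y) ⬝ᵥ A *ᵥ (h + y)) + K ⬝ᵥ (h + y)) :=
        (integral_add_left_eq_self (μ := (volume : Measure (ι → ℝ)))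
          (fun x : ι → ℝ => Real.exp (-(1 / 2 : ℝ) * (x ⬝ᵥ A *ᵥ x) + K ⬝ᵥ x)) h).symm
    _ = ∫ y : ι → ℝ, Real.exp ((1 / 2 : ℝ) * (K ⬝ᵥ h)) * Real.exp (-(1 / 2 : ℝ) * (y ⬝ᵥ A *ᵥ y)) := by
        refine integral_congr_ae (Filter.Eventually.of_forall fun y => ?_)
        show Real.exp (-(1 / 2 : ℝ) * ((h + y) ⬝ᵥ A *ᵥ (h + y)) + K ⬝ᵥ (h + y)) = _
        rw [quad_shift A hA K h y hh, Real.exp_add]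
    _ = Real.exp ((1 / 2 : ℝ) * (K ⬝ᵥ A⁻¹ *ᵥ K)) * ∫ x : ι → ℝ, Real.exp (-(1 / 2 : ℝ) * (x ⬝ᵥ A *ᵥ x)) := by
        rw [integral_const_mul]

end SourceShift

/-! ## §4  (2.155) and (2.156) for the torus elimination scheme -/

section TwoOneFiveFive

/-- The substitution B = CB′ in the quadratic form (used for the first equality of (2.155)): ⟨CB′, ΔCB′⟩ = ⟨B′, C*ΔC B′⟩.
[folklore] -/
theorem quad_sandwich {m n : Type*} [Fintype m] [Fintype n] (C : Matrix m n ℝ) (Δ : Matrix m m ℝ) (w : n → ℝ) :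
    (C *ᵥ w) ⬝ᵥ Δ *ᵥ (C *ᵥ w) = w ⬝ᵥ (Cᵀ * Δ * C) *ᵥ w := by
  rw [← Matrix.mulVec_mulVec, ← Matrix.mulVec_mulVec, Matrix.dotProduct_mulVec w Cᵀ, Matrix.vecMul_transpose]

/-- ⟨J, CB′⟩ = ⟨C*J, B′⟩. [folklore] -/
theorem lin_sandwich {m n : Type*} [Fintype m] [Fintype n] (C : Matrix m n ℝ) (J : m → ℝ) (w : n → ℝ) :
    J ⬝ᵥ (C *ᵥ w) = (Cᵀ *ᵥ J) ⬝ᵥ w := by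
  rw [Matrix.dotProduct_mulVec, Matrix.mulVec_transpose]

/-- **⟨C*J, X C*J⟩ = ⟨J, (C X C*) J⟩** — reading the covariance off the exponent of (2.155): with X = (C*Δ_kC)⁻¹ the
right-hand side is the quadratic form of C(C*Δ_kC)⁻¹C* of (2.156). [cite: Balaban1984PropagatorsII, (2.156) p.250] -/
theorem quad_cov {m n : Type*} [Fintype m] [Fintype n] (C : Matrix m n ℝ) (X : Matrix n n ℝ) (J : m → ℝ) :
    J ⬝ᵥ (C * X * Cᵀ) *ᵥ J = (Cᵀ *ᵥ J) ⬝ᵥ X *ᵥ (Cᵀ *ᵥ J) := by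
  rw [← Matrix.mulVec_mulVec, ← Matrix.mulVec_mulVec, Matrix.dotProduct_mulVec J C, Matrix.mulVec_transpose]

variable (L) (M)

/-- THE FIRST B′-INTEGRAL of (2.155) written with B = CB′: ∫dB′ e^{−½⟨CB′,ΔCB′⟩+⟨J,CB′⟩} — the integrand of (2.154)
evaluated on the fibre B = CB′ (Lebesgue measure dB′ on ℝ^{remaining variables}).
[cite: Balaban1984PropagatorsII, (2.154)–(2.155) pp.249–250] -/
def redInt (Δ : Matrix (B4.Idx (pbox M) d) (B4.Idx (pbox M) d) ℝ) (J : B4.Idx (pbox M) d → ℝ) : ℝ :=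
  ∫ w : freeT L M → ℝ,
    Real.exp (-(1 / 2 : ℝ) * ((elimT L M *ᵥ w) ⬝ᵥ Δ *ᵥ (elimT L M *ᵥ w)) + J ⬝ᵥ (elimT L M *ᵥ w))

/-- Z′^{(k)} of (2.155): the UNEVALUATED centred Gaussian integral ∫dB′ e^{−½⟨B′,C*ΔCB′⟩} of the reduced form.
[cite: Balaban1984PropagatorsII, (2.155) p.250] -/
def Zred (Δ : Matrix (B4.Idx (pbox M) d) (B4.Idx (pbox M) d) ℝ) : ℝ :=
  ∫ w : freeT L M → ℝ, Real.exp (-(1 / 2 : ℝ) * (w ⬝ᵥ ((elimT L M)ᵀ * Δ * elimT L M) *ᵥ w))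

variable {L M}

/-- KERNEL-CHECKED: `redInt` IS the first integral of (2.155), ∫dB′ e^{−½⟨B′,C*ΔCB′⟩+⟨C*J,B′⟩}.
[cite: Balaban1984PropagatorsII, (2.155) p.250] -/
theorem redInt_eq_first (Δ : Matrix (B4.Idx (pbox M) d) (B4.Idx (pbox M) d) ℝ) (J : B4.Idx (pbox M) d → ℝ) :
    redInt L M Δ J = ∫ w : freeT L M → ℝ,
      Real.exp (-(1 / 2 : ℝ) * (w ⬝ᵥ ((elimT L M)ᵀ * Δ * elimT L M) *ᵥ w) + ((elimT L M)ᵀ *ᵥ J) ⬝ᵥ w) := by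
  unfold redInt
  simp_rw [quad_sandwich, lin_sandwich]

/-- C(C*ΔC)⁻¹C* is symmetric for Δ symmetric. [folklore] -/
theorem cov_isSymm {Δ : Matrix (B4.Idx (pbox M) d) (B4.Idx (pbox M) d) ℝ} (hΔ : Δ.IsSymm) :
    (elimT L M * ((elimT L M)ᵀ * Δ * elimT L M)⁻¹ * (elimT L M)ᵀ).IsSymm := by
  have hA : ((elimT L M)ᵀ * Δ * elimT L M).IsSymm := B6FromB4.sandwich_isSymm (elimT L M) hΔ
  have h := B6FromB4.sandwich_isSymm (elimT L M)ᵀ hA.inv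
  rwa [Matrix.transpose_transpose] at h

/-- The quadratic form of `(bondReductionT L M Δ).cov` = C(C*ΔC)⁻¹C* is the exponent of (2.155):
⟨J, C(C*ΔC)⁻¹C* J⟩ = ⟨C*J, (C*ΔC)⁻¹C*J⟩. [cite: Balaban1984PropagatorsII, (2.155)–(2.156) p.250] -/
theorem cov_quad [∀ μ, NeZero (M μ)] (Δ : Matrix (B4.Idx (pbox M) d) (B4.Idx (pbox M) d) ℝ)
    (J : B4.Idx (pbox M) d → ℝ) :
    J ⬝ᵥ (bondReductionT L M Δ).cov *ᵥ J =
      ((elimT L M)ᵀ *ᵥ J) ⬝ᵥ ((elimT L M)ᵀ * Δ * elimT L M)⁻¹ *ᵥ ((elimT L M)ᵀ *ᵥ J) := by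
  rw [← quad_cov]
  rfl

/-- **KERNEL-CHECKED, THE SECOND EQUALITY OF (2.155)**: for Δ symmetric with det(C*ΔC) a unit,
∫dB′ e^{−½⟨B′,C*ΔCB′⟩+⟨C*J,B′⟩} = Z′ · e^{½⟨C*J,(C*ΔC)⁻¹C*J⟩} = Z′ · e^{½⟨J, C(C*ΔC)⁻¹C* J⟩}, with Z′ = `Zred` left
unevaluated and C(C*ΔC)⁻¹C* = `(bondReductionT L M Δ).cov` of (2.156).
[cite: Balaban1984PropagatorsII, (2.155)–(2.156) p.250] -/
theorem redInt_eq [∀ μ, NeZero (M μ)] {Δ : Matrix (B4.Idx (pbox M) d) (B4.Idx (pbox M) d) ℝ} (hΔ : Δ.IsSymm)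
    (hdet : IsUnit ((elimT L M)ᵀ * Δ * elimT L M).det) (J : B4.Idx (pbox M) d → ℝ) :
    redInt L M Δ J = Real.exp ((1 / 2 : ℝ) * (J ⬝ᵥ (bondReductionT L M Δ).cov *ᵥ J)) * Zred L M Δ := by
  rw [cov_quad, redInt_eq_first, integral_exp_quad_lin _ (B6FromB4.sandwich_isSymm (elimT L M) hΔ) hdet]
  rfl

/-- **KERNEL-CHECKED, THE DISPLAY (2.155)** for the torus scheme (Λ′ = the faces of the torus):
(L^d)^{|Λ′|} ∫dB′ e^{−½⟨B′,C*ΔCB′⟩+⟨C*J,B′⟩} = (L^d)^{|Λ′|} Z′ e^{½⟨C*J,(C*ΔC)⁻¹C*J⟩}; the prefactor is |det Ψ_{Λ′}|⁻¹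
of §1 (`coordT_det`, `integral_comp_coordT`). [cite: Balaban1984PropagatorsII, (2.155) p.250] -/
theorem eq_2155 [∀ μ, NeZero (M μ)] {Δ : Matrix (B4.Idx (pbox M) d) (B4.Idx (pbox M) d) ℝ} (hΔ : Δ.IsSymm)
    (hdet : IsUnit ((elimT L M)ᵀ * Δ * elimT L M).det) (J : B4.Idx (pbox M) d → ℝ) :
    ((L : ℝ) ^ d) ^ (faces L M).card * redInt L M Δ J =
      ((L : ℝ) ^ d) ^ (faces L M).card * Zred L M Δ *
        Real.exp ((1 / 2 : ℝ) * (((elimT L M)ᵀ *ᵥ J) ⬝ᵥ ((elimT L M)ᵀ * Δ * elimT L M)⁻¹ *ᵥ ((elimT L M)ᵀ *ᵥ J))) := by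
  rw [redInt_eq hΔ hdet, cov_quad]
  ring

/-- **KERNEL-CHECKED, the word «hence» before (2.156)**: C(C*Δ_kC)⁻¹C* is THE symmetric matrix S with ⟨J,SJ⟩ = ⟨C*J,(C*Δ_kC)⁻¹C*J⟩
for all J — the covariance read off the generating function Z·e^{½⟨J,SJ⟩} of (2.154)/(2.155) (a symmetric matrix is
determined by its quadratic form, `eq_of_quad_eq` upstream). [cite: Balaban1984PropagatorsII, (2.156) p.250] -/
theorem cov_unique {Δ : Matrix (B4.Idx (pbox M) d) (B4.Idx (pbox M) d) ℝ} (hΔ : Δ.IsSymm)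
    {S : Matrix (B4.Idx (pbox M) d) (B4.Idx (pbox M) d) ℝ} (hS : S.IsSymm)
    (hq : ∀ J : B4.Idx (pbox M) d → ℝ,
      J ⬝ᵥ S *ᵥ J = ((elimT L M)ᵀ *ᵥ J) ⬝ᵥ ((elimT L M)ᵀ * Δ * elimT L M)⁻¹ *ᵥ ((elimT L M)ᵀ *ᵥ J)) :
    S = elimT L M * ((elimT L M)ᵀ * Δ * elimT L M)⁻¹ * (elimT L M)ᵀ := by
  refine eq_of_quad_eq hS (cov_isSymm hΔ) fun J => ?_
  have h := hq J
  rw [← quad_cov] at h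
  simpa only [dotProduct] using h

/-- The same, for the upstream instance: S = `(bondReductionT L M Δ).cov` = C^{(k)} of (2.156).
[cite: Balaban1984PropagatorsII, (2.156) p.250] -/
theorem cov_unique' [∀ μ, NeZero (M μ)] {Δ : Matrix (B4.Idx (pbox M) d) (B4.Idx (pbox M) d) ℝ} (hΔ : Δ.IsSymm)
    {S : Matrix (B4.Idx (pbox M) d) (B4.Idx (pbox M) d) ℝ} (hS : S.IsSymm)
    (hq : ∀ J : B4.Idx (pbox M) d → ℝ,
      J ⬝ᵥ S *ᵥ J = ((elimT L M)ᵀ *ᵥ J) ⬝ᵥ ((elimT L M)ᵀ * Δ * elimT L M)⁻¹ *ᵥ ((elimT L M)ᵀ *ᵥ J)) :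
    S = (bondReductionT L M Δ).cov := by
  rw [bondReductionT_cov]
  exact cov_unique hΔ hS hq

end TwoOneFiveFive

/-! ## §5  The same for the Λ-integral, Λ = B(Λ′₀) ⊂ T^(k) (the scheme of `B6Cov2156TorusSubset`) -/

section Lam

open B6LowerBound2153Torus (InLam facesOf mem_facesOf)
open B6Cov2156TorusSubset (IsLam lamFree lamFree_subset elimLam mem_lamFree mem_lamFree_iff isLam_iff_of_cOf_mem
  elimLam_mulVec_eq_zero q1_elimLam_mulVec elimLam_mulVec_tree elimLam_restr elimTS_mulVec_mem)

variable (L) (M) (Λ'₀ : Finset (Fin d → ℤ))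

/-- THE VARIABLES OF THE Λ-INTEGRAL (2.152)/(2.154), «∫dB↾_Λ»: the Λ-bonds of the torus (at least one end-point in
Λ = B(Λ′₀), Lemma 2.4's convention, `B6Cov2156TorusSubset.IsLam`). [cite: Balaban1984PropagatorsII, p.245, p.249] -/
abbrev LamIdx : Type := {p : B4.Idx (pbox M) d // IsLam L M Λ'₀ p}

/-- A configuration of the Λ-bonds extended by zero to all bonds of the torus (the print works with such B: «CB′ = 0
outside Λ», p.250). [cite: Balaban1984PropagatorsII, p.250; dictionary] -/
def zeroExt (B : LamIdx L M Λ'₀ → ℝ) : B4.Idx (pbox M) d → ℝ := fun p =>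
  if hp : IsLam L M Λ'₀ p then B ⟨p, hp⟩ else 0

/-- THE COORDINATE CHANGE Ψ^Λ OF THE Λ-INTEGRAL: the Λ-bond block of Ψ_K with K = the coarse bonds meeting Λ′₀
(`facesOf`, the constraints δ((QB)(c)) of the Λ-integral); its pivot rows are B ↦ (Q₁B^per)(c) of B extended by
zero outside Λ (`coordLam_mulVec_apply`). [cite: Balaban1984PropagatorsII, (2.154)–(2.155) pp.249–250] -/
def coordLam : Matrix (LamIdx L M Λ'₀) (LamIdx L M Λ'₀) ℝ :=
  toSquareBlockProp (coordT L M (facesOf L M Λ'₀)) (IsLam L M Λ'₀)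

/-- C_ΛB′ as a configuration of the Λ-bonds (it vanishes outside Λ, `elimLam_mulVec_eq_zero` upstream).
[cite: Balaban1984PropagatorsII, p.250 *"CB′ = 0 outside Λ"*; dictionary] -/
def lamVec (w : lamFree L M Λ'₀ → ℝ) : LamIdx L M Λ'₀ → ℝ := fun q => (elimLam L M Λ'₀ *ᵥ w) q.1

/-- B′ (the remaining Λ-variables `lamFree`) extended by zero to the Λ-bonds. [folklore] -/
def extLam (w : lamFree L M Λ'₀ → ℝ) : LamIdx L M Λ'₀ → ℝ := fun q =>
  if hq : q.1 ∈ lamFree L M Λ'₀ then w ⟨q.1, hq⟩ else 0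

variable {L M Λ'₀}

/-- B̃ = B on the Λ-bonds. [folklore] -/
theorem zeroExt_apply_of_isLam (B : LamIdx L M Λ'₀ → ℝ) {p : B4.Idx (pbox M) d} (hp : IsLam L M Λ'₀ p) :
    zeroExt L M Λ'₀ B p = B ⟨p, hp⟩ :=
  dif_pos hp

/-- B̃ = 0 outside Λ. [folklore] -/
theorem zeroExt_apply_of_not_isLam (B : LamIdx L M Λ'₀ → ℝ) {p : B4.Idx (pbox M) d} (hp : ¬ IsLam L M Λ'₀ p) :
    zeroExt L M Λ'₀ B p = 0 :=
  dif_neg hp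

/-- The constraints of the Λ-integral are among the faces of the torus. [folklore] -/
theorem facesOf_subset_faces : facesOf L M Λ'₀ ⊆ faces L M := fun _ hc => ((mem_facesOf M).1 hc).1

/-- Ψ^Λ B = (Ψ_K B̃)↾Λ-bonds with B̃ = B extended by zero outside Λ, K = `facesOf`. [folklore] -/
theorem coordLam_mulVec (B : LamIdx L M Λ'₀ → ℝ) (q : LamIdx L M Λ'₀) :
    (coordLam L M Λ'₀ *ᵥ B) q =
      (coordT L M (facesOf L M Λ'₀) *ᵥ zeroExt L M Λ'₀ B) (q.1 : B4.Idx (pbox M) d) := by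
  simp only [coordLam, Matrix.mulVec, dotProduct, toSquareBlockProp_def, Matrix.of_apply]
  rw [← Fintype.sum_subtype_add_sum_subtype (IsLam L M Λ'₀)
    (fun j => coordT L M (facesOf L M Λ'₀) q.1 j * zeroExt L M Λ'₀ B j)]
  rw [Finset.sum_eq_zero (s := (Finset.univ : Finset {x // ¬ IsLam L M Λ'₀ x}))
    (fun a _ => by simp only [zeroExt_apply_of_not_isLam B a.2, mul_zero]), add_zero]
  exact Finset.sum_congr rfl fun a _ => by rw [zeroExt_apply_of_isLam B a.2]

/-- KERNEL-CHECKED: (Ψ^Λ B)(b₀(c)) = (Q₁B̃^per)(c) for the coarse bonds c meeting Λ′₀ (B̃ = B extended by zero outside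
Λ), (Ψ^Λ B)(b) = B(b) at every other Λ-bond. [cite: Balaban1984PropagatorsII, p.249] -/
theorem coordLam_mulVec_apply [∀ μ, NeZero (M μ)] (B : LamIdx L M Λ'₀ → ℝ) (q : LamIdx L M Λ'₀) :
    (coordLam L M Λ'₀ *ᵥ B) q =
      if cOf L (q.1.1 : Fin d → ℤ) q.1.2 ∈ facesOf L M Λ'₀ then
        q1 L (perExt M (zeroExt L M Λ'₀ B)) (cOf L (q.1.1 : Fin d → ℤ) q.1.2)
      else B q := by
  rw [coordLam_mulVec, coordT_mulVec_apply]
  split_ifs with h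
  · rfl
  · exact zeroExt_apply_of_isLam B q.2

/-- Ψ^Λ is block-lower-triangular. [folklore] -/
theorem coordLam_lower :
    ∀ i : LamIdx L M Λ'₀, ¬ IsPiv L M (facesOf L M Λ'₀) i.1 →
      ∀ j : LamIdx L M Λ'₀, IsPiv L M (facesOf L M Λ'₀) j.1 → coordLam L M Λ'₀ i j = 0 :=
  fun i hi j hj => coordT_lower _ i.1 hi j.1 hj

/-- The pivot block of Ψ^Λ is L^{−d}·𝟙. [folklore] -/
theorem coordLam_pivBlock [∀ μ, NeZero (M μ)] (hL : 0 < L) (hLM : ∀ i, L ∣ M i) :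
    toSquareBlockProp (coordLam L M Λ'₀) (fun i => IsPiv L M (facesOf L M Λ'₀) i.1) =
      ((L : ℝ) ^ d)⁻¹ • (1 : Matrix _ _ ℝ) := by
  ext i j
  rw [toSquareBlockProp_def, Matrix.of_apply, Matrix.smul_apply, smul_eq_mul, Matrix.one_apply]
  show coordT L M (facesOf L M Λ'₀) i.1.1 j.1.1 = _
  rw [coordT_piv_piv hL hLM facesOf_subset_faces i.2 j.2]
  by_cases h : i = j
  · subst h
    rw [if_pos rfl, if_pos rfl, mul_one]
  · rw [if_neg (fun e => h (Subtype.ext (Subtype.ext e)).symm), if_neg h, mul_zero]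

/-- The other diagonal block of Ψ^Λ is 𝟙. [folklore] -/
theorem coordLam_freeBlock :
    toSquareBlockProp (coordLam L M Λ'₀) (fun i => ¬ IsPiv L M (facesOf L M Λ'₀) i.1) = 1 := by
  ext i j
  rw [toSquareBlockProp_def, Matrix.of_apply, Matrix.one_apply]
  show coordT L M (facesOf L M Λ'₀) i.1.1 j.1.1 = _
  rw [coordT_apply, if_neg i.2]
  by_cases h : i = j
  · subst h
    rw [if_pos rfl, if_pos rfl]
  · rw [if_neg (fun e => h (Subtype.ext (Subtype.ext e)).symm), if_neg h]

/-- The pivot b₀(c) of a coarse bond c meeting Λ′₀ is a Λ-bond (`isLam_iff_of_cOf_mem` upstream). [folklore] -/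
theorem isLam_piv [∀ μ, NeZero (M μ)] (hL : 0 < L) (hLM : ∀ i, L ∣ M i) {c : (Fin d → ℤ) × Fin d}
    (hc : c ∈ facesOf L M Λ'₀) :
    IsLam L M Λ'₀ (⟨pivSite L c, pivSite_mem_pbox hL hLM (facesOf_subset_faces hc)⟩, c.2) := by
  have e : cOf L (pivSite L c) c.2 = c := by rw [cOf_pivSite]
  refine (isLam_iff_of_cOf_mem hL (pos_of_neZero M) hLM ?_).2 ?_
  · show cOf L (pivSite L c) c.2 ∈ faces L M
    rw [e]
    exact facesOf_subset_faces hc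
  · show cOf L (pivSite L c) c.2 ∈ facesOf L M Λ'₀
    rw [e]
    exact hc

/-- The pivots of the Λ-integral are in bijection with its constraints: |{b₀(c)}| = |{c meeting Λ′₀}|. [folklore] -/
theorem card_isPiv_lam [∀ μ, NeZero (M μ)] (hL : 0 < L) (hLM : ∀ i, L ∣ M i) :
    Fintype.card {i : LamIdx L M Λ'₀ // IsPiv L M (facesOf L M Λ'₀) i.1} = (facesOf L M Λ'₀).card := by
  rw [Fintype.card_subtype]
  refine Finset.card_bij' (fun i _ => cOf L (i.1.1 : Fin d → ℤ) i.1.2)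
    (fun c hc => ⟨(⟨pivSite L c, pivSite_mem_pbox hL hLM (facesOf_subset_faces hc)⟩, c.2), isLam_piv hL hLM hc⟩)
    ?_ ?_ ?_ ?_
  · intro i hi
    simpa using hi
  · intro c hc
    simp only [Finset.mem_filter, Finset.mem_univ, true_and]
    show cOf L (pivSite L c) c.2 ∈ facesOf L M Λ'₀
    rwa [cOf_pivSite]
  · intro i hi
    refine Subtype.ext (Prod.ext (Subtype.ext ?_) ?_)
    · show pivSite L (cOf L (i.1.1 : Fin d → ℤ) i.1.2) = (i.1.1 : Fin d → ℤ)
      rw [pivSite_cOf]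
    · show (cOf L (i.1.1 : Fin d → ℤ) i.1.2).2 = i.1.2
      rw [cOf_snd]
  · intro c hc
    show cOf L (pivSite L c) c.2 = c
    rw [cOf_pivSite]

/-- **KERNEL-CHECKED JACOBIAN OF THE Λ-INTEGRAL: det Ψ^Λ = (L^{−d})^{|Λ′|}**, |Λ′| = the number of coarse bonds meeting
Λ′₀ (the constraints δ((QB)(c)) of the Λ-integral). [cite: Balaban1984PropagatorsII, (2.155) p.250] -/
theorem coordLam_det [∀ μ, NeZero (M μ)] (hL : 0 < L) (hLM : ∀ i, L ∣ M i) :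
    (coordLam L M Λ'₀).det = (((L : ℝ) ^ d)⁻¹) ^ (facesOf L M Λ'₀).card := by
  rw [Matrix.twoBlockTriangular_det (coordLam L M Λ'₀) (fun i => IsPiv L M (facesOf L M Λ'₀) i.1) coordLam_lower,
    coordLam_pivBlock hL hLM, coordLam_freeBlock, Matrix.det_one, mul_one, Matrix.det_smul, Matrix.det_one, mul_one,
    card_isPiv_lam hL hLM]

/-- **KERNEL-CHECKED CHANGE OF VARIABLES FOR THE Λ-INTEGRAL: ∫ F(Ψ^Λ B) dB = (L^d)^{|Λ′|} ∫ F(y) dy** on ℝ^{Λ-bonds}.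
[cite: Balaban1984PropagatorsII, (2.155) p.250] -/
theorem integral_comp_coordLam [∀ μ, NeZero (M μ)] (hL : 0 < L) (hLM : ∀ i, L ∣ M i)
    (F : (LamIdx L M Λ'₀ → ℝ) → ℝ) :
    ∫ B, F (coordLam L M Λ'₀ *ᵥ B) = ((L : ℝ) ^ d) ^ (facesOf L M Λ'₀).card * ∫ y, F y := by
  have hLr : (0 : ℝ) < L := by exact_mod_cast hL
  have hdet : (coordLam L M Λ'₀).det ≠ 0 := by
    rw [coordLam_det hL hLM]
    positivity
  rw [integral_comp_mulVec (coordLam L M Λ'₀) hdet F, coordLam_det hL hLM, abs_of_pos (by positivity), ← inv_pow,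
    inv_inv]

/-- C_ΛB′ extended by zero from the Λ-bonds is C_ΛB′ («CB′ = 0 outside Λ», upstream). [folklore] -/
theorem zeroExt_lamVec [∀ μ, NeZero (M μ)] (hL : 0 < L) (hLM : ∀ i, L ∣ M i) (w : lamFree L M Λ'₀ → ℝ) :
    zeroExt L M Λ'₀ (lamVec L M Λ'₀ w) = elimLam L M Λ'₀ *ᵥ w := by
  funext p
  by_cases hp : IsLam L M Λ'₀ p
  · rw [zeroExt_apply_of_isLam _ hp]
    rfl
  · rw [zeroExt_apply_of_not_isLam _ hp, elimLam_mulVec_eq_zero hL hLM w hp]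

/-- **KERNEL-CHECKED: Ψ^Λ(C_ΛB′) = ext B′** — remaining Λ-coordinates B′, pivot coordinates (Q₁(C_ΛB′))(c) = 0 at the
coarse bonds meeting Λ′₀, tree coordinates 0 on the blocks of Λ′₀. [cite: Balaban1984PropagatorsII, (2.155) p.250] -/
theorem coordLam_mulVec_elimLam [∀ μ, NeZero (M μ)] (hL : 0 < L) (hLM : ∀ i, L ∣ M i)
    (w : lamFree L M Λ'₀ → ℝ) : coordLam L M Λ'₀ *ᵥ lamVec L M Λ'₀ w = extLam L M Λ'₀ w := by
  funext q
  rw [coordLam_mulVec_apply, zeroExt_lamVec hL hLM]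
  unfold extLam
  by_cases hc : cOf L (q.1.1 : Fin d → ℤ) q.1.2 ∈ facesOf L M Λ'₀
  · rw [if_pos hc, q1_elimLam_mulVec hL hLM w (facesOf_subset_faces hc), dif_neg]
    exact fun h => ((mem_lamFree_iff hL (pos_of_neZero M) hLM).1 h).2.1 hc
  · rw [if_neg hc]
    show (elimLam L M Λ'₀ *ᵥ w) q.1 = _
    by_cases hf : q.1 ∈ lamFree L M Λ'₀
    · rw [dif_pos hf]
      exact elimTS_mulVec_mem (lamFree_subset L M Λ'₀) w ⟨q.1, hf⟩
    · rw [dif_neg hf]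
      have ht : IsTree L (coarseSites L M ∩ Λ'₀) q.1 := by
        by_contra ht
        exact hf ((mem_lamFree_iff hL (pos_of_neZero M) hLM).2 ⟨q.2, hc, ht⟩)
      exact elimLam_mulVec_tree w ⟨(Finset.mem_inter.1 ht.1).1, ht.2⟩

/-- **KERNEL-CHECKED: C_ΛB′ = (Ψ^Λ)⁻¹(ext B′)** on the Λ-bonds. [cite: Balaban1984PropagatorsII, p.250] -/
theorem lamVec_eq_coordLam_inv_mulVec [∀ μ, NeZero (M μ)] (hL : 0 < L) (hLM : ∀ i, L ∣ M i)
    (w : lamFree L M Λ'₀ → ℝ) : lamVec L M Λ'₀ w = (coordLam L M Λ'₀)⁻¹ *ᵥ extLam L M Λ'₀ w := by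
  have hLr : (0 : ℝ) < L := by exact_mod_cast hL
  have hdet : IsUnit (coordLam L M Λ'₀).det := by
    rw [coordLam_det hL hLM, isUnit_iff_ne_zero]
    positivity
  rw [← coordLam_mulVec_elimLam hL hLM w, Matrix.mulVec_mulVec, Matrix.nonsing_inv_mul _ hdet, Matrix.one_mulVec]

/-- **KERNEL-CHECKED: for the Λ-integral, δ(QB)δ_{Ax}(B) is the δ-function of the non-remaining coordinates of Ψ^Λ B**
— a configuration B of the Λ-bonds (zero outside Λ) satisfies (Q₁B^per)(c) = 0 at the coarse bonds meeting Λ′₀ and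
B(Γ_{y,x}) = 0 on the blocks B(y), y ∈ Λ′₀, IFF Ψ^Λ B vanishes at every Λ-bond which is not a remaining variable.
[cite: Balaban1984PropagatorsII, (2.154)–(2.155) pp.249–250] -/
theorem constrained_iff_lam [∀ μ, NeZero (M μ)] (hL : 0 < L) (hLM : ∀ i, L ∣ M i) (B : LamIdx L M Λ'₀ → ℝ) :
    ((∀ c ∈ facesOf L M Λ'₀, q1 L (perExt M (zeroExt L M Λ'₀ B)) c = 0) ∧
        ∀ q : LamIdx L M Λ'₀, IsTree L (coarseSites L M ∩ Λ'₀) q.1 → B q = 0) ↔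
      ∀ q : LamIdx L M Λ'₀, q.1 ∉ lamFree L M Λ'₀ → (coordLam L M Λ'₀ *ᵥ B) q = 0 := by
  have hM0 := pos_of_neZero M
  constructor
  · rintro ⟨h1, h2⟩ q hq
    rw [coordLam_mulVec_apply]
    by_cases hc : cOf L (q.1.1 : Fin d → ℤ) q.1.2 ∈ facesOf L M Λ'₀
    · rw [if_pos hc]
      exact h1 _ hc
    · rw [if_neg hc]
      have ht : IsTree L (coarseSites L M ∩ Λ'₀) q.1 := by
        by_contra ht
        exact hq ((mem_lamFree_iff hL hM0 hLM).2 ⟨q.2, hc, ht⟩)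
      exact h2 q ht
  · intro h
    refine ⟨fun c hc => ?_, fun q hq => ?_⟩
    · have hcF : c ∈ faces L M := facesOf_subset_faces hc
      set q : LamIdx L M Λ'₀ := ⟨(⟨pivSite L c, pivSite_mem_pbox hL hLM hcF⟩, c.2), isLam_piv hL hLM hc⟩
        with hq_def
      have hcq : cOf L (q.1.1 : Fin d → ℤ) q.1.2 = c := by
        show cOf L (pivSite L c) c.2 = c
        rw [cOf_pivSite]
      have hqf : q.1 ∉ lamFree L M Λ'₀ := fun hf =>
        ((mem_lamFree_iff hL hM0 hLM).1 hf).2.1 (by rw [hcq]; exact hc)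
      have h0 := h q hqf
      rw [coordLam_mulVec_apply, hcq, if_pos hc] at h0
      exact h0
    · have hqf : q.1 ∉ lamFree L M Λ'₀ := fun hf => ((mem_lamFree_iff hL hM0 hLM).1 hf).2.2 hq
      have h0 := h q hqf
      rw [coordLam_mulVec_apply] at h0
      by_cases hc : cOf L (q.1.1 : Fin d → ℤ) q.1.2 ∈ facesOf L M Λ'₀
      · exfalso
        refine not_isTree_of_piv hL (faces_dvd (facesOf_subset_faces hc)) q.1 ?_ ?_
          (show IsTree L (coarseSites L M) q.1 from ⟨(Finset.mem_inter.1 hq.1).1, hq.2⟩)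
        · rw [pivSite_cOf]
        · rw [cOf_snd]
      · rwa [if_neg hc] at h0

/-- KERNEL-CHECKED (the fibre of the Λ-integral): a constrained, axially gauged configuration B of the Λ-bonds is
C_Λ applied to its remaining coordinates (upstream `elimLam_restr`), and Ψ^Λ B = ext(B↾remaining).
[cite: Balaban1984PropagatorsII, (2.154)–(2.155) pp.249–250] -/
theorem coordLam_mulVec_of_constrained [∀ μ, NeZero (M μ)] (hL : 0 < L) (hLM : ∀ i, L ∣ M i)
    {B : LamIdx L M Λ'₀ → ℝ} (h1 : ∀ c ∈ facesOf L M Λ'₀, q1 L (perExt M (zeroExt L M Λ'₀ B)) c = 0)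
    (h2 : ∀ q : LamIdx L M Λ'₀, IsTree L (coarseSites L M ∩ Λ'₀) q.1 → B q = 0) :
    elimLam L M Λ'₀ *ᵥ (fun k => zeroExt L M Λ'₀ B k) = zeroExt L M Λ'₀ B ∧
      coordLam L M Λ'₀ *ᵥ B = extLam L M Λ'₀ (fun k => zeroExt L M Λ'₀ B k) := by
  have e := elimLam_restr hL hLM (B := zeroExt L M Λ'₀ B) (fun p hp => zeroExt_apply_of_not_isLam B hp) h1
    (fun p hp => by
      by_cases hl : IsLam L M Λ'₀ p
      · rw [zeroExt_apply_of_isLam B hl]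
        exact h2 ⟨p, hl⟩ hp
      · exact zeroExt_apply_of_not_isLam B hl)
  refine ⟨e, ?_⟩
  have hv : lamVec L M Λ'₀ (fun k => zeroExt L M Λ'₀ B k) = B := by
    funext q
    show (elimLam L M Λ'₀ *ᵥ fun k => zeroExt L M Λ'₀ B k) q.1 = B q
    rw [e, zeroExt_apply_of_isLam B q.2]
  conv_lhs => rw [← hv]
  exact coordLam_mulVec_elimLam hL hLM _

end Lam

/-! ## §6  Z′^{(k)} evaluated (v1.1): C*Δ_kC > 0 from (2.153)_T, and Z′ = √(2π)^{|B′|} / √det(C*Δ_kC) -/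

section ZPrime

open Beta.GaussianIntegral (integral_exp_neg_half_quadForm)
open B6Cov2156Torus (LowerOnConstrainedT Represents gamma2153 gamma2153_pos lowerOnConstrainedT_of_represents
  elimT_iso q1_elimT_mulVec elimT_mulVec_tree deltaPol deltaPol_isSymm represents_deltaPol)
open B6Cov2156TorusSubset (elimTS elimTS_iso elimTS_mulVec_tree q1_elimTS_mulVec subFamilyT subFamilyT_cov
  lamFree lamFree_subset elimLam bondReductionLam)

/-- Σ w² > 0 for w ≠ 0. [folklore] -/
theorem sum_sq_pos {κ : Type*} [Fintype κ] {w : κ → ℝ} (hw : w ≠ 0) : 0 < ∑ i, w i ^ 2 := by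
  obtain ⟨i, hi⟩ : ∃ i, w i ≠ 0 := Function.ne_iff.mp hw
  exact lt_of_lt_of_le (by positivity) (Finset.single_le_sum (fun j _ => sq_nonneg (w j)) (Finset.mem_univ i))

/-- KERNEL-CHECKED: (2.153)_T with constant γ ≥ 0 on {QB = 0, B(Γ_{y,x}) = 0} and ‖CB′‖ ≥ ‖B′‖ (`elimT_iso`) give
γ‖B′‖² ≤ ⟨B′, C*ΔC B′⟩ — the two inequalities of *"⟨B′, C*Δ_kCB′⟩ ≥ (γ₀/12d²)L^{−d−1}‖CB′‖² ≥ γ′₀‖B′‖², (2.157)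
where γ′₀ = (γ₀/12d²)L^{−d−1}"* composed, for a general (2.153)_T-constant γ in place of γ′₀ (the printed γ′₀ for
the (1.66) form: `ineq_2157_deltaPol`, §8).  (v1.1's docstring carried a misquotation of this display — a
non-printed operator inequality with a wrong power of L; corrected here in v1.2, cell journal ERRATUM
2026-08-19T07:14:10Z.) [cite: Balaban1984PropagatorsII, (2.157) p.250] -/
theorem sandwich_lower [∀ μ, NeZero (M μ)] (hL : 0 < L) (hLM : ∀ i, L ∣ M i)
    {Δ : Matrix (B4.Idx (pbox M) d) (B4.Idx (pbox M) d) ℝ} {γ : ℝ} (hγ : 0 ≤ γ) (hl : LowerOnConstrainedT L M Δ γ)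
    (w : freeT L M → ℝ) : γ * ∑ f, w f ^ 2 ≤ w ⬝ᵥ ((elimT L M)ᵀ * Δ * elimT L M) *ᵥ w := by
  have h1 := hl (elimT L M *ᵥ w) (fun c hc => q1_elimT_mulVec hL hLM w hc) (fun p hp => elimT_mulVec_tree w hp)
  have h2 : γ * ∑ f, w f ^ 2 ≤ γ * ∑ p, (elimT L M *ᵥ w) p ^ 2 := mul_le_mul_of_nonneg_left (elimT_iso w) hγ
  rw [← quad_sandwich]
  exact h2.trans h1

/-- **KERNEL-CHECKED: C*Δ_kC IS POSITIVE DEFINITE** on ℝ^{B′} for Δ symmetric with (2.153)_T, γ > 0 (so (C*Δ_kC)⁻¹ of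
(2.155)/(2.156) is a genuine inverse and Z′ converges). [cite: Balaban1984PropagatorsII, (2.155)–(2.157) p.250] -/
theorem sandwich_posDef [∀ μ, NeZero (M μ)] (hL : 0 < L) (hLM : ∀ i, L ∣ M i)
    {Δ : Matrix (B4.Idx (pbox M) d) (B4.Idx (pbox M) d) ℝ} (hs : Δ.IsSymm) {γ : ℝ} (hγ : 0 < γ)
    (hl : LowerOnConstrainedT L M Δ γ) : ((elimT L M)ᵀ * Δ * elimT L M).PosDef := by
  refine Matrix.PosDef.of_dotProduct_mulVec_pos ?_ fun w hw => ?_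
  · rw [Matrix.isHermitian_iff_isSymm]
    exact B6FromB4.sandwich_isSymm (elimT L M) hs
  · rw [star_trivial]
    exact lt_of_lt_of_le (mul_pos hγ (sum_sq_pos hw)) (sandwich_lower hL hLM hγ.le hl w)

/-- **KERNEL-CHECKED: Z′^{(k)} EVALUATED** — for C*ΔC positive definite, Z′ = ∫dB′ e^{−½⟨B′,C*ΔCB′⟩} =
√(2π)^{|B′|} / √det(C*ΔC), |B′| = the number of remaining variables (the Gaussian integral of a positive definite
form, `Beta.GaussianIntegral.integral_exp_neg_half_quadForm` of the sibling module, by name).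
[cite: Balaban1984PropagatorsII, (2.155) p.250] -/
theorem Zred_eq {Δ : Matrix (B4.Idx (pbox M) d) (B4.Idx (pbox M) d) ℝ}
    (hpos : ((elimT L M)ᵀ * Δ * elimT L M).PosDef) :
    Zred L M Δ = Real.sqrt (2 * Real.pi) ^ (freeT L M).card / Real.sqrt ((elimT L M)ᵀ * Δ * elimT L M).det := by
  rw [Zred, integral_exp_neg_half_quadForm _ hpos, Fintype.card_coe]

/-- Z′^{(k)} > 0. [folklore] -/
theorem Zred_pos {Δ : Matrix (B4.Idx (pbox M) d) (B4.Idx (pbox M) d) ℝ}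
    (hpos : ((elimT L M)ᵀ * Δ * elimT L M).PosDef) : 0 < Zred L M Δ := by
  rw [Zred_eq hpos]
  exact div_pos (pow_pos (Real.sqrt_pos.2 (by positivity)) _) (Real.sqrt_pos.2 hpos.det_pos)

/-- **KERNEL-CHECKED, (2.155) WITH Z′ EVALUATED** for the torus scheme: Δ symmetric with (2.153)_T (γ > 0) ⟹
(L^d)^{|Λ′|} ∫dB′ e^{−½⟨CB′,ΔCB′⟩+⟨J,CB′⟩} = (L^d)^{|Λ′|} · √(2π)^{|B′|}/√det(C*ΔC) · e^{½⟨C*J,(C*ΔC)⁻¹C*J⟩}.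
[cite: Balaban1984PropagatorsII, (2.155) p.250] -/
theorem eq_2155_eval [∀ μ, NeZero (M μ)] (hL : 0 < L) (hLM : ∀ i, L ∣ M i)
    {Δ : Matrix (B4.Idx (pbox M) d) (B4.Idx (pbox M) d) ℝ} (hs : Δ.IsSymm) {γ : ℝ} (hγ : 0 < γ)
    (hl : LowerOnConstrainedT L M Δ γ) (J : B4.Idx (pbox M) d → ℝ) :
    ((L : ℝ) ^ d) ^ (faces L M).card * redInt L M Δ J =
      ((L : ℝ) ^ d) ^ (faces L M).card *
        (Real.sqrt (2 * Real.pi) ^ (freeT L M).card / Real.sqrt ((elimT L M)ᵀ * Δ * elimT L M).det) *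
        Real.exp ((1 / 2 : ℝ) *
          (((elimT L M)ᵀ *ᵥ J) ⬝ᵥ ((elimT L M)ᵀ * Δ * elimT L M)⁻¹ *ᵥ ((elimT L M)ᵀ *ᵥ J))) := by
  have hpos := sandwich_posDef hL hLM hs hγ hl
  rw [eq_2155 hs (isUnit_iff_ne_zero.2 hpos.det_pos.ne') J, Zred_eq hpos]

/-- **KERNEL-CHECKED, FOR Δ_k OF THE (1.66) FORM** (Δ_k = `deltaPol M n`, THE matrix of `formDk n M` in the bond basis,
upstream): C*Δ_kC is positive definite — UNCONDITIONALLY for d ≥ 2, L ≥ 1, n ≥ 1, L ∣ M_i ((2.153)_T discharged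
upstream by `lowerOnConstrainedT_of_represents`, γ = `gamma2153 d L` > 0). [cite: Balaban1984PropagatorsII, (2.157) p.250] -/
theorem sandwich_posDef_deltaPol [∀ μ, NeZero (M μ)] (hd : 2 ≤ d) (hL : 1 ≤ L) (hLM : ∀ i, L ∣ M i) (n : ℕ)
    (hn : 1 ≤ n) : ((elimT L M)ᵀ * deltaPol M n * elimT L M).PosDef :=
  sandwich_posDef hL hLM (deltaPol_isSymm M n) (gamma2153_pos (le_trans (by norm_num) hd) hL)
    (lowerOnConstrainedT_of_represents M hd hL n hn hLM (represents_deltaPol M n))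

/-- **KERNEL-CHECKED: Z′^{(k)} = √(2π)^{|B′|} / √det(C*Δ_kC) FOR THE (1.66) FORM**, unconditionally.
[cite: Balaban1984PropagatorsII, (2.155) p.250] -/
theorem Zred_deltaPol [∀ μ, NeZero (M μ)] (hd : 2 ≤ d) (hL : 1 ≤ L) (hLM : ∀ i, L ∣ M i) (n : ℕ) (hn : 1 ≤ n) :
    Zred L M (deltaPol M n) =
      Real.sqrt (2 * Real.pi) ^ (freeT L M).card / Real.sqrt ((elimT L M)ᵀ * deltaPol M n * elimT L M).det :=
  Zred_eq (sandwich_posDef_deltaPol hd hL hLM n hn)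

/-- **KERNEL-CHECKED, THE DISPLAY (2.155) FOR Δ_k OF THE (1.66) FORM ON THE TORUS, EVERYTHING EVALUATED**: for d ≥ 2,
L ≥ 1, n ≥ 1, L ∣ M_i and every source J,
(L^d)^{|Λ′|} ∫dB′ e^{−½⟨CB′,Δ_kCB′⟩+⟨J,CB′⟩} = (L^d)^{|Λ′|} · √(2π)^{|B′|}/√det(C*Δ_kC) · e^{½⟨C*J,(C*Δ_kC)⁻¹C*J⟩} — NO
hypothesis on Δ_k left (its decay is not needed for (2.155)). [cite: Balaban1984PropagatorsII, (2.155) p.250] -/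
theorem eq_2155_deltaPol [∀ μ, NeZero (M μ)] (hd : 2 ≤ d) (hL : 1 ≤ L) (hLM : ∀ i, L ∣ M i) (n : ℕ) (hn : 1 ≤ n)
    (J : B4.Idx (pbox M) d → ℝ) :
    ((L : ℝ) ^ d) ^ (faces L M).card * redInt L M (deltaPol M n) J =
      ((L : ℝ) ^ d) ^ (faces L M).card *
        (Real.sqrt (2 * Real.pi) ^ (freeT L M).card / Real.sqrt ((elimT L M)ᵀ * deltaPol M n * elimT L M).det) *
        Real.exp ((1 / 2 : ℝ) * (((elimT L M)ᵀ *ᵥ J) ⬝ᵥ ((elimT L M)ᵀ * deltaPol M n * elimT L M)⁻¹ *ᵥ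
          ((elimT L M)ᵀ *ᵥ J))) :=
  eq_2155_eval hL hLM (deltaPol_isSymm M n) (gamma2153_pos (le_trans (by norm_num) hd) hL)
    (lowerOnConstrainedT_of_represents M hd hL n hn hLM (represents_deltaPol M n)) J

end ZPrime

/-! ## §7  (2.155), (2.156) and Z′ for every sub-family C_S of the torus scheme — in particular for C_Λ (v1.1) -/

section SubFamily

open Beta.GaussianIntegral (integral_exp_neg_half_quadForm)
open B6Cov2156Torus (LowerOnConstrainedT gamma2153 gamma2153_pos lowerOnConstrainedT_of_represents deltaPol
  deltaPol_isSymm represents_deltaPol)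
open B6LowerBound2153Torus (facesOf)
open B6Cov2156TorusSubset (elimTS elimTS_iso elimTS_mulVec_tree q1_elimTS_mulVec subFamilyT subFamilyT_cov
  lamFree lamFree_subset elimLam bondReductionLam)

variable (L) (M)

/-- The first B′-integral of (2.155) for a sub-family S of the remaining torus variables (C = C_S = `elimTS`; S =
`lamFree L M Λ'₀` gives the Λ-integral, C_S = C_Λ): ∫dB′ e^{−½⟨C_SB′,ΔC_SB′⟩+⟨J,C_SB′⟩}.
[cite: Balaban1984PropagatorsII, (2.154)–(2.155) pp.249–250] -/
def redIntS (S : Finset (B4.Idx (pbox M) d)) (hS : S ⊆ freeT L M)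
    (Δ : Matrix (B4.Idx (pbox M) d) (B4.Idx (pbox M) d) ℝ) (J : B4.Idx (pbox M) d → ℝ) : ℝ :=
  ∫ w : S → ℝ, Real.exp (-(1 / 2 : ℝ) * ((elimTS L M S hS *ᵥ w) ⬝ᵥ Δ *ᵥ (elimTS L M S hS *ᵥ w)) +
    J ⬝ᵥ (elimTS L M S hS *ᵥ w))

/-- Z′ for the sub-family S: ∫dB′ e^{−½⟨B′,C_S*ΔC_SB′⟩}. [cite: Balaban1984PropagatorsII, (2.155) p.250] -/
def ZredS (S : Finset (B4.Idx (pbox M) d)) (hS : S ⊆ freeT L M)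
    (Δ : Matrix (B4.Idx (pbox M) d) (B4.Idx (pbox M) d) ℝ) : ℝ :=
  ∫ w : S → ℝ, Real.exp (-(1 / 2 : ℝ) * (w ⬝ᵥ ((elimTS L M S hS)ᵀ * Δ * elimTS L M S hS) *ᵥ w))

variable {L M}
variable {S : Finset (B4.Idx (pbox M) d)} (hS : S ⊆ freeT L M)

/-- `redIntS` IS ∫dB′ e^{−½⟨B′,C_S*ΔC_SB′⟩+⟨C_S*J,B′⟩}. [cite: Balaban1984PropagatorsII, (2.155) p.250] -/
theorem redIntS_eq_first (Δ : Matrix (B4.Idx (pbox M) d) (B4.Idx (pbox M) d) ℝ) (J : B4.Idx (pbox M) d → ℝ) :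
    redIntS L M S hS Δ J = ∫ w : S → ℝ,
      Real.exp (-(1 / 2 : ℝ) * (w ⬝ᵥ ((elimTS L M S hS)ᵀ * Δ * elimTS L M S hS) *ᵥ w) +
        ((elimTS L M S hS)ᵀ *ᵥ J) ⬝ᵥ w) := by
  unfold redIntS
  simp_rw [quad_sandwich, lin_sandwich]

/-- C_S(C_S*ΔC_S)⁻¹C_S* is symmetric for Δ symmetric. [folklore] -/
theorem covS_isSymm {Δ : Matrix (B4.Idx (pbox M) d) (B4.Idx (pbox M) d) ℝ} (hΔ : Δ.IsSymm) :
    (elimTS L M S hS * ((elimTS L M S hS)ᵀ * Δ * elimTS L M S hS)⁻¹ * (elimTS L M S hS)ᵀ).IsSymm := by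
  have hA : ((elimTS L M S hS)ᵀ * Δ * elimTS L M S hS).IsSymm := B6FromB4.sandwich_isSymm (elimTS L M S hS) hΔ
  have h := B6FromB4.sandwich_isSymm (elimTS L M S hS)ᵀ hA.inv
  rwa [Matrix.transpose_transpose] at h

/-- ⟨J, C_S(C_S*ΔC_S)⁻¹C_S* J⟩ = ⟨C_S*J, (C_S*ΔC_S)⁻¹C_S*J⟩ for `.cov` of the upstream sub-family reduction
(`subFamilyT_cov`, rfl). [cite: Balaban1984PropagatorsII, (2.155)–(2.156) p.250] -/
theorem covS_quad (Δ : Matrix (B4.Idx (pbox M) d) (B4.Idx (pbox M) d) ℝ) (J : B4.Idx (pbox M) d → ℝ) :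
    J ⬝ᵥ (subFamilyT L M S hS Δ).cov *ᵥ J =
      ((elimTS L M S hS)ᵀ *ᵥ J) ⬝ᵥ ((elimTS L M S hS)ᵀ * Δ * elimTS L M S hS)⁻¹ *ᵥ ((elimTS L M S hS)ᵀ *ᵥ J) := by
  rw [← quad_cov]
  rfl

/-- **KERNEL-CHECKED, THE SECOND EQUALITY OF (2.155) FOR C_S**: Δ symmetric, det(C_S*ΔC_S) a unit ⟹
∫dB′ e^{−½⟨B′,C_S*ΔC_SB′⟩+⟨C_S*J,B′⟩} = Z′_S · e^{½⟨J, C_S(C_S*ΔC_S)⁻¹C_S* J⟩}. [cite: Balaban1984PropagatorsII, (2.155) p.250] -/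
theorem redIntS_eq {Δ : Matrix (B4.Idx (pbox M) d) (B4.Idx (pbox M) d) ℝ} (hΔ : Δ.IsSymm)
    (hdet : IsUnit ((elimTS L M S hS)ᵀ * Δ * elimTS L M S hS).det) (J : B4.Idx (pbox M) d → ℝ) :
    redIntS L M S hS Δ J = Real.exp ((1 / 2 : ℝ) * (J ⬝ᵥ (subFamilyT L M S hS Δ).cov *ᵥ J)) * ZredS L M S hS Δ := by
  rw [covS_quad, redIntS_eq_first, integral_exp_quad_lin _ (B6FromB4.sandwich_isSymm (elimTS L M S hS) hΔ) hdet]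
  rfl

/-- **KERNEL-CHECKED, the word «hence» before (2.156), FOR C_S**: C_S(C_S*ΔC_S)⁻¹C_S* = `(subFamilyT L M S hS Δ).cov` is THE symmetric
matrix with the quadratic form ⟨C_S*J,(C_S*ΔC_S)⁻¹C_S*J⟩. [cite: Balaban1984PropagatorsII, (2.156) p.250] -/
theorem cov_uniqueS {Δ : Matrix (B4.Idx (pbox M) d) (B4.Idx (pbox M) d) ℝ} (hΔ : Δ.IsSymm)
    {T : Matrix (B4.Idx (pbox M) d) (B4.Idx (pbox M) d) ℝ} (hT : T.IsSymm)
    (hq : ∀ J : B4.Idx (pbox M) d → ℝ, J ⬝ᵥ T *ᵥ J =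
      ((elimTS L M S hS)ᵀ *ᵥ J) ⬝ᵥ ((elimTS L M S hS)ᵀ * Δ * elimTS L M S hS)⁻¹ *ᵥ ((elimTS L M S hS)ᵀ *ᵥ J)) :
    T = (subFamilyT L M S hS Δ).cov := by
  rw [subFamilyT_cov]
  refine eq_of_quad_eq hT (covS_isSymm hS hΔ) fun J => ?_
  have h := hq J
  rw [← quad_cov] at h
  simpa only [dotProduct] using h

/-- KERNEL-CHECKED: γ‖B′‖² ≤ ⟨B′, C_S*ΔC_S B′⟩ from (2.153)_T and ‖C_SB′‖ ≥ ‖B′‖ (`elimTS_iso` upstream).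
[cite: Balaban1984PropagatorsII, (2.157) p.250] -/
theorem sandwich_lowerS [∀ μ, NeZero (M μ)] (hL : 0 < L) (hLM : ∀ i, L ∣ M i)
    {Δ : Matrix (B4.Idx (pbox M) d) (B4.Idx (pbox M) d) ℝ} {γ : ℝ} (hγ : 0 ≤ γ) (hl : LowerOnConstrainedT L M Δ γ)
    (w : S → ℝ) : γ * ∑ k, w k ^ 2 ≤ w ⬝ᵥ ((elimTS L M S hS)ᵀ * Δ * elimTS L M S hS) *ᵥ w := by
  have h1 := hl (elimTS L M S hS *ᵥ w) (fun c hc => q1_elimTS_mulVec hS hL hLM w hc)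
    (fun p hp => elimTS_mulVec_tree hS w hp)
  have h2 : γ * ∑ k, w k ^ 2 ≤ γ * ∑ p, (elimTS L M S hS *ᵥ w) p ^ 2 :=
    mul_le_mul_of_nonneg_left (elimTS_iso hS w) hγ
  rw [← quad_sandwich]
  exact h2.trans h1

/-- **KERNEL-CHECKED: C_S*ΔC_S IS POSITIVE DEFINITE** (Δ symmetric with (2.153)_T, γ > 0) — in particular C_Λ*Δ_kC_Λ of
the Λ-integral. [cite: Balaban1984PropagatorsII, (2.155)–(2.157) p.250] -/
theorem sandwich_posDefS [∀ μ, NeZero (M μ)] (hL : 0 < L) (hLM : ∀ i, L ∣ M i)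
    {Δ : Matrix (B4.Idx (pbox M) d) (B4.Idx (pbox M) d) ℝ} (hs : Δ.IsSymm) {γ : ℝ} (hγ : 0 < γ)
    (hl : LowerOnConstrainedT L M Δ γ) : ((elimTS L M S hS)ᵀ * Δ * elimTS L M S hS).PosDef := by
  refine Matrix.PosDef.of_dotProduct_mulVec_pos ?_ fun w hw => ?_
  · rw [Matrix.isHermitian_iff_isSymm]
    exact B6FromB4.sandwich_isSymm (elimTS L M S hS) hs
  · rw [star_trivial]
    exact lt_of_lt_of_le (mul_pos hγ (sum_sq_pos hw)) (sandwich_lowerS hS hL hLM hγ.le hl w)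

/-- **KERNEL-CHECKED: Z′_S = √(2π)^{|S|} / √det(C_S*ΔC_S)** for C_S*ΔC_S positive definite.
[cite: Balaban1984PropagatorsII, (2.155) p.250] -/
theorem ZredS_eq {Δ : Matrix (B4.Idx (pbox M) d) (B4.Idx (pbox M) d) ℝ}
    (hpos : ((elimTS L M S hS)ᵀ * Δ * elimTS L M S hS).PosDef) :
    ZredS L M S hS Δ = Real.sqrt (2 * Real.pi) ^ S.card / Real.sqrt ((elimTS L M S hS)ᵀ * Δ * elimTS L M S hS).det := by
  rw [ZredS, integral_exp_neg_half_quadForm _ hpos, Fintype.card_coe]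

/-- **KERNEL-CHECKED, (2.155) FOR THE SUB-FAMILY S WITH Z′ EVALUATED**: Δ symmetric with (2.153)_T (γ > 0) ⟹
∫dB′ e^{−½⟨C_SB′,ΔC_SB′⟩+⟨J,C_SB′⟩} = √(2π)^{|S|}/√det(C_S*ΔC_S) · e^{½⟨J, C_S(C_S*ΔC_S)⁻¹C_S* J⟩}.
[cite: Balaban1984PropagatorsII, (2.155)–(2.156) p.250] -/
theorem redIntS_eval [∀ μ, NeZero (M μ)] (hL : 0 < L) (hLM : ∀ i, L ∣ M i)
    {Δ : Matrix (B4.Idx (pbox M) d) (B4.Idx (pbox M) d) ℝ} (hs : Δ.IsSymm) {γ : ℝ} (hγ : 0 < γ)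
    (hl : LowerOnConstrainedT L M Δ γ) (J : B4.Idx (pbox M) d → ℝ) :
    redIntS L M S hS Δ J =
      Real.sqrt (2 * Real.pi) ^ S.card / Real.sqrt ((elimTS L M S hS)ᵀ * Δ * elimTS L M S hS).det *
        Real.exp ((1 / 2 : ℝ) * (J ⬝ᵥ (subFamilyT L M S hS Δ).cov *ᵥ J)) := by
  have hpos := sandwich_posDefS hS hL hLM hs hγ hl
  rw [redIntS_eq hS hs (isUnit_iff_ne_zero.2 hpos.det_pos.ne') J, ZredS_eq hS hpos, mul_comm]

/-- **KERNEL-CHECKED, THE DISPLAY (2.155) FOR THE Λ-INTEGRAL OF Δ_k OF THE (1.66) FORM, EVERYTHING EVALUATED**: for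
d ≥ 2, L ≥ 1, n ≥ 1, L ∣ M_i, every Λ′₀ and every source J, with |Λ′| = the number of coarse bonds meeting Λ′₀
(`facesOf`, the Jacobian of §5 `coordLam_det` / `integral_comp_coordLam`), B′ = `lamFree`, C = C_Λ = `elimLam`:
(L^d)^{|Λ′|} ∫dB′ e^{−½⟨C_ΛB′,Δ_kC_ΛB′⟩+⟨J,C_ΛB′⟩} = (L^d)^{|Λ′|} · √(2π)^{|B′|}/√det(C_Λ*Δ_kC_Λ) · e^{½⟨J,C^{(k)}_Λ J⟩},
C^{(k)}_Λ = `(bondReductionLam L M Λ'₀ (deltaPol M n)).cov` = C_Λ(C_Λ*Δ_kC_Λ)⁻¹C_Λ* — NO hypothesis on Δ_k left.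
[cite: Balaban1984PropagatorsII, (2.155)–(2.156) p.250] -/
theorem eq_2155_lam_deltaPol [∀ μ, NeZero (M μ)] (hd : 2 ≤ d) (hL : 1 ≤ L) (hLM : ∀ i, L ∣ M i) (n : ℕ)
    (hn : 1 ≤ n) (Λ'₀ : Finset (Fin d → ℤ)) (J : B4.Idx (pbox M) d → ℝ) :
    ((L : ℝ) ^ d) ^ (facesOf L M Λ'₀).card * redIntS L M (lamFree L M Λ'₀) (lamFree_subset L M Λ'₀) (deltaPol M n) J =
      ((L : ℝ) ^ d) ^ (facesOf L M Λ'₀).card *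
        (Real.sqrt (2 * Real.pi) ^ (lamFree L M Λ'₀).card /
            Real.sqrt ((elimLam L M Λ'₀)ᵀ * deltaPol M n * elimLam L M Λ'₀).det *
          Real.exp ((1 / 2 : ℝ) * (J ⬝ᵥ (bondReductionLam L M Λ'₀ (deltaPol M n)).cov *ᵥ J))) := by
  rw [redIntS_eval (lamFree_subset L M Λ'₀) hL hLM (deltaPol_isSymm M n)
    (gamma2153_pos (le_trans (by norm_num) hd) hL)
    (lowerOnConstrainedT_of_represents M hd hL n hn hLM (represents_deltaPol M n)) J]

/-- KERNEL-CHECKED: C_Λ*Δ_kC_Λ > 0 and Z′ of the Λ-integral = √(2π)^{|B′|}/√det(C_Λ*Δ_kC_Λ) for the (1.66) form,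
unconditionally. [cite: Balaban1984PropagatorsII, (2.155)–(2.157) p.250] -/
theorem ZredLam_deltaPol [∀ μ, NeZero (M μ)] (hd : 2 ≤ d) (hL : 1 ≤ L) (hLM : ∀ i, L ∣ M i) (n : ℕ) (hn : 1 ≤ n)
    (Λ'₀ : Finset (Fin d → ℤ)) :
    ((elimLam L M Λ'₀)ᵀ * deltaPol M n * elimLam L M Λ'₀).PosDef ∧
      ZredS L M (lamFree L M Λ'₀) (lamFree_subset L M Λ'₀) (deltaPol M n) =
        Real.sqrt (2 * Real.pi) ^ (lamFree L M Λ'₀).card /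
          Real.sqrt ((elimLam L M Λ'₀)ᵀ * deltaPol M n * elimLam L M Λ'₀).det := by
  have hpos := sandwich_posDefS (lamFree_subset L M Λ'₀) hL hLM (deltaPol_isSymm M n)
    (gamma2153_pos (le_trans (by norm_num) hd) hL)
    (lowerOnConstrainedT_of_represents M hd hL n hn hLM (represents_deltaPol M n))
  exact ⟨hpos, ZredS_eq _ hpos⟩

end SubFamily

/-! ## §8  (2.157) with its printed constant γ′₀ = (γ₀/12d²)L^{−d−1} for the (1.66) form (v1.2) -/

section Ineq2157

open B6Cov2156Torus (LowerOnConstrainedT gamma2153 gamma2153_pos lowerOnConstrainedT_of_represents elimT_iso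
  q1_elimT_mulVec elimT_mulVec_tree deltaPol represents_deltaPol)
open B6Cov2156TorusSubset (elimTS elimTS_iso elimTS_mulVec_tree q1_elimTS_mulVec lamFree lamFree_subset elimLam)

/-- γ′₀ unfolded: `gamma2153 d L` = ((4/π²)^{d+2}/(12d²))·L^{−(d+1)} = (γ₀/12d²)L^{−d−1} with γ₀ = (4/π²)^{d+2} (rfl).
[cite: Balaban1984PropagatorsII, (2.157) p.250, (2.153) p.249] -/
theorem gamma2153_eq (d L : ℕ) :
    gamma2153 d L = (4 / Real.pi ^ 2) ^ (d + 2) / (12 * (d : ℝ) ^ 2) * (L : ℝ) ^ (-((d : ℝ) + 1)) := rfl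

/-- KERNEL-CHECKED, THE FIRST INEQUALITY OF (2.157): *"The inequality (2.153) implies ⟨B′, C*Δ_kCB′⟩ ≥
(γ₀/12d²)L^{−d−1}‖CB′‖²"* — (2.153)_T (constant γ) applied at B = CB′, which satisfies QCB′ = 0, (CB′)(Γ_{y,x}) = 0
(`q1_elimT_mulVec`, `elimT_mulVec_tree` upstream). [cite: Balaban1984PropagatorsII, (2.157) p.250] -/
theorem ineq_2157_mid [∀ μ, NeZero (M μ)] (hL : 0 < L) (hLM : ∀ i, L ∣ M i)
    {Δ : Matrix (B4.Idx (pbox M) d) (B4.Idx (pbox M) d) ℝ} {γ : ℝ} (hl : LowerOnConstrainedT L M Δ γ)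
    (w : freeT L M → ℝ) :
    γ * ∑ p, (elimT L M *ᵥ w) p ^ 2 ≤ w ⬝ᵥ ((elimT L M)ᵀ * Δ * elimT L M) *ᵥ w := by
  have h1 := hl (elimT L M *ᵥ w) (fun c hc => q1_elimT_mulVec hL hLM w hc) (fun p hp => elimT_mulVec_tree w hp)
  rw [← quad_sandwich]
  exact h1

/-- **KERNEL-CHECKED, (2.157) VERBATIM WITH ITS PRINTED CONSTANT for Δ_k of the (1.66) form on the torus**:
*"⟨B′, C*Δ_kCB′⟩ ≥ (γ₀/12d²)L^{−d−1}‖CB′‖² ≥ γ′₀‖B′‖², (2.157) where γ′₀ = (γ₀/12d²)L^{−d−1}"* — both inequalities,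
γ′₀ = `gamma2153 d L` (γ₀ = (4/π²)^{d+2} of (1.67) = (2.118), (2.153) discharged upstream by
`lowerOnConstrainedT_of_represents`), ‖CB′‖ ≥ ‖B′‖ = `elimT_iso`; unconditionally for d ≥ 2, L ≥ 1, n ≥ 1, L ∣ M_i.
[cite: Balaban1984PropagatorsII, (2.157) p.250] -/
theorem ineq_2157_deltaPol [∀ μ, NeZero (M μ)] (hd : 2 ≤ d) (hL : 1 ≤ L) (hLM : ∀ i, L ∣ M i) (n : ℕ)
    (hn : 1 ≤ n) (w : freeT L M → ℝ) :
    gamma2153 d L * ∑ p, (elimT L M *ᵥ w) p ^ 2 ≤ w ⬝ᵥ ((elimT L M)ᵀ * deltaPol M n * elimT L M) *ᵥ w ∧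
      gamma2153 d L * ∑ f, w f ^ 2 ≤ gamma2153 d L * ∑ p, (elimT L M *ᵥ w) p ^ 2 :=
  ⟨ineq_2157_mid hL hLM (lowerOnConstrainedT_of_represents M hd hL n hn hLM (represents_deltaPol M n)) w,
    mul_le_mul_of_nonneg_left (elimT_iso w) (gamma2153_pos (le_trans (by norm_num) hd) hL).le⟩

variable {S : Finset (B4.Idx (pbox M) d)} (hS : S ⊆ freeT L M)

/-- KERNEL-CHECKED, the first inequality of (2.157) for a sub-family C_S (in particular C_Λ): γ‖C_SB′‖² ≤
⟨B′, C_S*ΔC_SB′⟩. [cite: Balaban1984PropagatorsII, (2.157) p.250] -/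
theorem ineq_2157_midS [∀ μ, NeZero (M μ)] (hL : 0 < L) (hLM : ∀ i, L ∣ M i)
    {Δ : Matrix (B4.Idx (pbox M) d) (B4.Idx (pbox M) d) ℝ} {γ : ℝ} (hl : LowerOnConstrainedT L M Δ γ)
    (w : S → ℝ) : γ * ∑ p, (elimTS L M S hS *ᵥ w) p ^ 2 ≤ w ⬝ᵥ ((elimTS L M S hS)ᵀ * Δ * elimTS L M S hS) *ᵥ w := by
  have h1 := hl (elimTS L M S hS *ᵥ w) (fun c hc => q1_elimTS_mulVec hS hL hLM w hc)
    (fun p hp => elimTS_mulVec_tree hS w hp)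
  rw [← quad_sandwich]
  exact h1

/-- **KERNEL-CHECKED, (2.157) WITH ITS PRINTED CONSTANT FOR C_Λ** («hence for C^{(k)}_Λ also»): both inequalities
⟨B′, C_Λ*Δ_kC_ΛB′⟩ ≥ γ′₀‖C_ΛB′‖² ≥ γ′₀‖B′‖², γ′₀ = `gamma2153 d L`, for the (1.66) form, unconditionally.
[cite: Balaban1984PropagatorsII, (2.157) p.250] -/
theorem ineq_2157_lam_deltaPol [∀ μ, NeZero (M μ)] (hd : 2 ≤ d) (hL : 1 ≤ L) (hLM : ∀ i, L ∣ M i) (n : ℕ)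
    (hn : 1 ≤ n) (Λ'₀ : Finset (Fin d → ℤ)) (w : lamFree L M Λ'₀ → ℝ) :
    gamma2153 d L * ∑ p, (elimLam L M Λ'₀ *ᵥ w) p ^ 2 ≤
        w ⬝ᵥ ((elimLam L M Λ'₀)ᵀ * deltaPol M n * elimLam L M Λ'₀) *ᵥ w ∧
      gamma2153 d L * ∑ f, w f ^ 2 ≤ gamma2153 d L * ∑ p, (elimLam L M Λ'₀ *ᵥ w) p ^ 2 :=
  ⟨ineq_2157_midS (lamFree_subset L M Λ'₀) hL hLM
      (lowerOnConstrainedT_of_represents M hd hL n hn hLM (represents_deltaPol M n)) w,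
    mul_le_mul_of_nonneg_left (elimTS_iso (lamFree_subset L M Λ'₀) w)
      (gamma2153_pos (le_trans (by norm_num) hd) hL).le⟩

end Ineq2157

end

end Literature.MathematicalPhysics.QuantumFieldTheory.Balaban1983to89.B6Jacobian2155Torus
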